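import Mathlib
import Literature.Barriers.NavierStokesRegularity.DyadicCascadeRegularityProofs
import HarnessLib

/-!
# Cheskidov's dyadic model: finite-time blow-up for `α < 1/3`
  (proof of the named fact `Dyadic.Cheskidov2008_thm53`)

Barrier catalogue `Literature/Barriers/NavierStokesRegularity/`, second sibling **proof file** of
`DyadicCascadeRegularity` (the first, `DyadicCascadeRegularityProofs`, proves Thm. 4.4): it proves
`theorem Cheskidov2008_thm53_holds : Cheskidov2008_thm53`, i.e. Theorem 5.3 of Cheskidov 2008 in
the range `0 < γ < min{1/3, 1 - 3α}` its printed proof covers (as vendored): for `λ > 1`, `ν > 0`,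
`0 < α < 1/3`, a non-negative force `g ∈ ℓ²` and such `γ` there is a finite `M` such that every
solution `u` of the dyadic model (3.1) (Def. 3.1: `ℓ²`-valued, `C¹` modes on `[0, ∞)`) with
`uₙ(0) ≥ 0` and `‖u(0)‖²_γ > M` has `∫₀ᵀ ‖u(t)‖³_{1/3+γ} dt = ∞` for some `T > 0`
("`‖u(t)‖³_{1/3+γ}` is not locally integrable"). Theorem-only module (no definitions, no
notation: the recurring weighted sums are written out in full).

## The printed proof (Cheskidov 2008, §5, pp. 9–10 of the arXiv text) and its transcription

* **Positivity** (Thm. 4.2: `uₙ(t) ≥ 0`, from the integrating-factor formula for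
  `uₙ' = -(νλ^{2αn} + λ^{n+1}uₙ₊₁)uₙ + λⁿu²ₙ₋₁ + gₙ`). Here `nonneg_of_isCheskidovSolution`, via the
  fencing lemma `nonneg_of_deriv_linear` (Mathlib's `image_le_of_deriv_right_lt_deriv_boundary'`
  with the barriers `εe^{(K+1)t}`). The solution is then re-written time-first and extended
  constantly to `t < 0` (`extend_isCheskidovSolution`), which changes nothing on `[0, ∞)`.
* **Lemma 5.1** (Hölder with `p = 3`, `q = 3/2`: `∑λ^{(1+2γ)n}uₙ³ ≥ A‖u‖³_{α+γ}`). Here in two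
  forms: `energy_cube_le` (`(∑_{n≤N}λ^{2γn}uₙ²)³ ≤ S(∑_{n≤N}λ^{(1+2γ)n}uₙ³)²`, Mathlib's
  `Real.inner_le_Lp_mul_Lq_of_nonneg`), which feeds `H^{3/2} ≲ ∑λ^{(1+2γ)n}uₙ³`
  (`lyapunov_rpow_le`, `lyapunov_rpow_le_tsum`); and the threshold form `dissipation_le`
  (`p∑λ^{2(α+γ)n}uₙ² ≤ q∑λ^{(1+2γ)n}uₙ³ + K'`, termwise from `px² ≤ qx³ + p³/q²` and the geometric
  series `∑λ^{-εn}`, `ε = 2 - 6α - 2γ > 0` — this is where `γ < 1 - 3α` enters), which replaces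
  the printed "assume `H(τ) ≥ M²` on `[0, t]`" by an additive constant.
* **The Lyapunov function** `H = ‖u‖²_γ + c₂∑λ^{2γn}uₙuₙ₊₁` and the inequalities (5.3)–(5.8)
  (`uₙu²ₙ₊₁ ≤ ½u³ₙ₊₁ + 2uₙ²uₙ₊₁`, `uₙuₙ₊₁uₙ₊₂ ≤ ½uₙ²uₙ₊₁ + ¼u³ₙ₊₂ + u²ₙ₊₁uₙ₊₂`, the `γ`-energy
  identity with `c₁ = λ^{2γ+1} - λ`, and
  `H(t) - H(0) ≥ -ν(2+c₃)∫‖u‖²_{α+γ} + (Aλc₂/4)∫‖u‖³_{α+γ}`). Here everything is first proved for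
  the TRUNCATIONS `H_N = ∑_{n≤N+1}λ^{2γn}uₙ² + c₂∑_{n≤N}λ^{2γn}uₙuₙ₊₁` at the level of states
  (`e_summand_eq`, `p_summand_lower`, `e_sum_lower`, `p_sum_lower`,
  `lyapunov_deriv_lower`: `dH_N/dt ≥ (c/2)∑_{n≤N}λ^{(1+2γ)n}uₙ³ - K' - R_N` with a remainder `R_N`
  made of single terms of the cubic and flux series; the printed coefficients `λ^{-2γ}/2`,
  `λ^{-4γ}/4`, `λ^{1-2γ}` are bounded by `1/2`, `1/4`, `λ`, so `c₂(3λ + λ²/2) = 2c₁` and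
  `c = c₂(λ - 3/4)`), then integrated along the solution by the fundamental theorem of calculus
  (`hasDerivWithinAt_lyapunov`, `lyapunovN_integral_ineq`), and the limit `N → ∞` is taken by
  monotone convergence in `[0, ∞]` (`lyapunov_integral_ineq`; the remainders tend to zero because
  `∑λ^{(1+2γ)n}uₙ³ ≤ ‖u‖³_{1/3+γ}` and `∑λ^{(1+2γ)n}uₙ²uₙ₊₁ ≤ 2∑λ^{(1+2γ)n}uₙ³` are integrable under
  the absurd hypothesis, `cubic_tsum_le`, `flux_tsum_le` — the first display of the printed
  proof). Working with `H = sup_N H_N ∈ [0, ∞]` makes Lemma 5.2 (continuity of `H`) and the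
  finiteness of `‖u(t)‖_γ` unnecessary, and the forcing term of (5.6) is simply dropped as
  non-negative, so the printed use of `γ ≤ 1/3` (integrability of that term) does not arise.
* **The Riccati blow-up** ("let `y` be the solution to `y' = cy^{3/2}` … `H(t)` also blows up in
  finite time, which contradicts …"). Here `lyapunov_blowup`, a discrete comparison: from
  `H(s) + c₀∫ₛᵗH^{3/2} ≤ H(t) + K(t-s)` and `H(0) ≥ h = 1 + 64K/c₀` the levels `4ᵏh` are reached
  at times `tₖ ≤ 64/c₀`, so `H = ∞` on `[64/c₀, 64/c₀+1]`; since `H ≤ (1+c₂)‖u‖²_{1/3+γ}`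
  (`lyapunov_le_dyadicNormSq`) the integrand `‖u‖³_{1/3+γ}` is `∞` on an interval of length one
  and the integral over `[0, T]`, `T = 64/c₀ + 1`, is infinite (`lintegral_eq_top_of_large`,
  `Cheskidov2008_thm53_holds`). The threshold is `M = 1 + 64K/c₀` with `c₀ = c/(2C_H)`, all
  constants explicit in `λ, ν, α, γ`.

## References

* A. Cheskidov, *Blow-up in finite time for the dyadic model of the Navier–Stokes equations*,
  Trans. Amer. Math. Soc. 360 (2008), 5101–5120; arXiv:math/0601074, §3 Def. 3.1, §4 Thm. 4.2,
  §5 Lemma 5.1, Lemma 5.2, Thm. 5.3 and its proof ((5.2)–(5.9)). [`Cheskidov2008`]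
-/

noncomputable section

open Set Filter Topology MeasureTheory
open scoped ENNReal NNReal

namespace Literature.Barriers.NavierStokesRegularity.Dyadic

variable {lam ν α γ : ℝ} {g : ℕ → ℝ}

/-! ## Weights `λ^θ`: products and comparisons -/

/-- `λ^a λ^b = λ^c` when `a + b = c` (`λ > 0`). [folklore] -/
theorem rpow_mul_rpow_eq (hlam : 0 < lam) {a b c : ℝ} (h : a + b = c) :
    lam ^ a * lam ^ b = lam ^ c := by
  rw [← h, Real.rpow_add hlam]

/-- `λ^a λ^n = λ^c` when `a + n = c`, `n` a natural exponent (`λ > 0`). [folklore] -/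
theorem rpow_mul_npow_eq (hlam : 0 < lam) {a c : ℝ} (n : ℕ) (h : a + n = c) :
    lam ^ a * lam ^ n = lam ^ c := by
  rw [← h, Real.rpow_add hlam, Real.rpow_natCast]

/-- `λ^a λ^n ≤ λ^c` when `a + n ≤ c` (`λ > 1`). [folklore] -/
theorem rpow_mul_npow_le (hlam : 1 < lam) {a c : ℝ} (n : ℕ) (h : a + n ≤ c) :
    lam ^ a * lam ^ n ≤ lam ^ c := by
  rw [← Real.rpow_natCast, ← Real.rpow_add (by linarith)]
  exact Real.rpow_le_rpow_of_exponent_le hlam.le h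

/-- Monotonicity of `θ ↦ λ^θ` for `λ > 1`. [folklore] -/
theorem rpow_le_rpow_exp (hlam : 1 < lam) {a c : ℝ} (h : a ≤ c) : lam ^ a ≤ lam ^ c :=
  Real.rpow_le_rpow_of_exponent_le hlam.le h

/-- The weights are positive. [folklore] -/
theorem rpow_pos' (hlam : 1 < lam) (a : ℝ) : 0 < lam ^ a :=
  Real.rpow_pos_of_pos (by linarith) _

/-- `λ λ^b = λ^c` when `1 + b = c` (`λ > 0`). [folklore] -/
theorem lam_mul_rpow_eq (hlam : 0 < lam) {b c : ℝ} (h : 1 + b = c) : lam * lam ^ b = lam ^ c := by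
  rw [← h, Real.rpow_add hlam, Real.rpow_one]


/-- The right-hand side of (3.1) at mode `m + 2`. [cite: Cheskidov2008, §3 (3.1)] -/
theorem cheskidovRHS_add_two (lam ν α : ℝ) (g u : ℕ → ℝ) (m : ℕ) :
    cheskidovRHS lam ν α g u (m + 2) =
      -ν * lam ^ (2 * α * (m + 2 : ℕ)) * u (m + 2) + lam ^ (m + 2) * u (m + 1) ^ 2 -
        lam ^ (m + 3) * u (m + 2) * u (m + 3) + g (m + 2) := by
  simp only [cheskidovRHS]
  rfl

section weights

variable (hlam : 1 < lam)
include hlam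

/-- `λ^{2γn}λ^{2αn} = λ^{2(α+γ)n}`. [folklore] -/
theorem w_gamma_alpha (m : ℕ) : (lam ^ ((2 * γ) * (m + 1 : ℕ))) * (lam ^ ((2 * α) * (m + 1 : ℕ))) =
    (lam ^ ((2 * (α + γ)) * (m + 1 : ℕ))) :=
  rpow_mul_rpow_eq (by linarith) (by push_cast; ring)

/-- `λ^{2γn}λ^{2α(n+1)} = λ^{2α}λ^{2(α+γ)n}`. [folklore] -/
theorem w_gamma_alpha_succ (m : ℕ) :
    (lam ^ ((2 * γ) * (m + 1 : ℕ))) * (lam ^ ((2 * α) * (m + 2 : ℕ))) = lam ^ (2 * α) *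
        (lam ^ ((2 * (α + γ)) * (m + 1 : ℕ))) := by
  rw [rpow_mul_rpow_eq (lam := lam) (by linarith) rfl,
      rpow_mul_rpow_eq (lam := lam) (by linarith) rfl]
  push_cast; ring_nf

/-- `λ^{2γn}λ^{n+1} = λ·λ^{(1+2γ)n}` (`n = m + 1`). [folklore] -/
theorem w_gamma_npow (m : ℕ) : (lam ^ ((2 * γ) * (m + 1 : ℕ))) * lam ^ (m + 2) = lam *
    (lam ^ ((1 + 2 * γ) * (m + 1 : ℕ))) := by
  rw [rpow_mul_npow_eq (lam := lam) (by linarith) (m + 2) rfl,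
      lam_mul_rpow_eq (lam := lam) (by linarith) rfl]
  push_cast; ring_nf

/-- `λ^{2γn}λ^{n+2} = λ²·λ^{(1+2γ)n}` (`n = m + 1`). [folklore] -/
theorem w_gamma_npow' (m : ℕ) :
    (lam ^ ((2 * γ) * (m + 1 : ℕ))) * lam ^ (m + 3) = lam ^ 2 *
        (lam ^ ((1 + 2 * γ) * (m + 1 : ℕ))) := by
  rw [rpow_mul_npow_eq (lam := lam) (by linarith) (m + 3) rfl, ← Real.rpow_natCast lam 2,
    rpow_mul_rpow_eq (lam := lam) (by linarith) rfl]
  push_cast; ring_nf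

/-- `λ^{2γ(k+2)}λ^{k+2} = λ^{1+2γ}·λ^{(1+2γ)(k+1)}`. [folklore] -/
theorem w_gamma_succ_npow (k : ℕ) :
    (lam ^ ((2 * γ) * (k + 2 : ℕ))) * lam ^ (k + 2) = lam ^ (1 + 2 * γ) *
        (lam ^ ((1 + 2 * γ) * (k + 1 : ℕ))) := by
  rw [rpow_mul_npow_eq (lam := lam) (by linarith) (k + 2) rfl,
      rpow_mul_rpow_eq (lam := lam) (by linarith) rfl]
  push_cast; ring_nf

/-- `λ^{2γn}λ^{n+1} ≤ λ^{(1+2γ)(n+1)}` for `γ ≥ 0` (`n = m + 1`). [folklore] -/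
theorem w_gamma_npow_le_one (hγ : 0 ≤ γ) (m : ℕ) :
    (lam ^ ((2 * γ) * (m + 1 : ℕ))) * lam ^ (m + 2) ≤ (lam ^ ((1 + 2 * γ) * (m + 2 : ℕ))) :=
  rpow_mul_npow_le hlam (m + 2) (by push_cast; nlinarith)

/-- `λ^{2γn}λ^{n+2} ≤ λ^{(1+2γ)(n+2)}` for `γ ≥ 0` (`n = m + 1`). [folklore] -/
theorem w_gamma_npow_le_two (hγ : 0 ≤ γ) (m : ℕ) :
    (lam ^ ((2 * γ) * (m + 1 : ℕ))) * lam ^ (m + 3) ≤ (lam ^ ((1 + 2 * γ) * (m + 3 : ℕ))) :=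
  rpow_mul_npow_le hlam (m + 3) (by push_cast; nlinarith)

/-- `λ^{2γn}λ^{n+2} ≤ λ·λ^{(1+2γ)(n+1)}` for `γ ≥ 0` (`n = m + 1`). [folklore] -/
theorem w_gamma_npow_le_three (hγ : 0 ≤ γ) (m : ℕ) :
    (lam ^ ((2 * γ) * (m + 1 : ℕ))) * lam ^ (m + 3) ≤ lam * (lam ^ ((1 + 2 * γ) * (m + 2 : ℕ))) :=
        by
  rw [lam_mul_rpow_eq (lam := lam) (by linarith) rfl]
  exact rpow_mul_npow_le hlam (m + 3) (by push_cast; nlinarith)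

/-- `λ^{θn} ≤ λ^{θ(n+1)}` for `θ ≥ 0`. [folklore] -/
theorem w_mono_succ {θ : ℝ} (hθ : 0 ≤ θ) (m : ℕ) : (lam ^ (θ * (m + 1 : ℕ))) ≤
    (lam ^ (θ * (m + 2 : ℕ))) :=
  rpow_le_rpow_exp hlam (by push_cast; nlinarith)

/-- `λ^{θk} ≤ λ^{θ'k}` for `θ ≤ θ'`. [folklore] -/
theorem w_le_w {θ θ' : ℝ} (h : θ ≤ θ') (k : ℕ) : (lam ^ (θ * (k : ℕ))) ≤ (lam ^ (θ' * (k : ℕ))) :=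
  rpow_le_rpow_exp hlam (mul_le_mul_of_nonneg_right h (Nat.cast_nonneg k))

end weights


/-! ## Elementary inequalities for non-negative reals -/

/-- `ab² ≤ ½b³ + 2a²b` for `a, b ≥ 0` ((5.3) of the printed proof: if `a ≤ b/2` then
`ab² ≤ b³/2`, otherwise `ab² ≤ 2a²b`). [cite: Cheskidov2008, §5 proof of Thm. 5.3] -/
theorem mul_sq_le_half_cube_add (a : ℝ) {b : ℝ} (hb : 0 ≤ b) :
    a * b ^ 2 ≤ b ^ 3 / 2 + 2 * a ^ 2 * b := by
  nlinarith [mul_nonneg hb (sq_nonneg (2 * a - b / 2)), mul_nonneg hb (sq_nonneg b)]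

/-- `abc ≤ ½a²b + ¼c³ + b²c` for `a, b, c ≥ 0` (the second displayed inequality of the printed
proof). [cite: Cheskidov2008, §5 proof of Thm. 5.3] -/
theorem mul_mul_le_of_nonneg (a : ℝ) {b c : ℝ} (hb : 0 ≤ b) (hc : 0 ≤ c) :
    a * b * c ≤ a ^ 2 * b / 2 + c ^ 3 / 4 + b ^ 2 * c := by
  have h1 : a * b * c ≤ a ^ 2 * b / 2 + b * c ^ 2 / 2 := by
    nlinarith [mul_nonneg hb (sq_nonneg (a - c))]
  have h2 := mul_sq_le_half_cube_add b hc
  linarith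

/-- `a²b ≤ a³ + b³` for `a, b ≥ 0`. [folklore] -/
theorem sq_mul_le_cube_add_cube {a b : ℝ} (ha : 0 ≤ a) (hb : 0 ≤ b) :
    a ^ 2 * b ≤ a ^ 3 + b ^ 3 := by
  nlinarith [mul_nonneg (add_nonneg ha hb) (sq_nonneg (a - b)), mul_nonneg ha (sq_nonneg b),
    mul_nonneg hb (sq_nonneg a)]

/-- `2ab ≤ a² + b²`. [folklore] -/
theorem two_mul_le_sq_add_sq (a b : ℝ) : 2 * (a * b) ≤ a ^ 2 + b ^ 2 := by
  nlinarith [sq_nonneg (a - b)]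

/-- Threshold form of `x² ≲ x³ + const`: `p x² ≤ q x³ + p³/q²` for `x, p ≥ 0`, `q > 0`
(if `x ≥ p/q` then `qx³ ≥ px²`, otherwise `px² ≤ p³/q²`). [folklore] -/
theorem sq_le_cube_add_const {p q x : ℝ} (hp : 0 ≤ p) (hq : 0 < q) (hx : 0 ≤ x) :
    p * x ^ 2 ≤ q * x ^ 3 + p ^ 3 / q ^ 2 := by
  rcases le_or_gt (p / q) x with h | h
  · have h1 : p ≤ q * x := by rwa [div_le_iff₀' hq] at h
    have : p * x ^ 2 ≤ q * x ^ 3 := by nlinarith [sq_nonneg x]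
    have : 0 ≤ p ^ 3 / q ^ 2 := by positivity
    linarith
  · have h1 : x < p / q := h
    have h2 : x ^ 2 ≤ (p / q) ^ 2 := pow_le_pow_left₀ hx h1.le 2
    have h3 : p * x ^ 2 ≤ p * (p / q) ^ 2 := mul_le_mul_of_nonneg_left h2 hp
    have h4 : p * (p / q) ^ 2 = p ^ 3 / q ^ 2 := by field_simp
    have : 0 ≤ q * x ^ 3 := by positivity
    linarith

/-! ## The weighted terms of a state

For a state `v : ℕ → ℝ` the index is shifted so that `m : ℕ` stands for the mode `n = m + 1`;
the recurring terms are the weighted energies `λ^{2θ(m+1)} v²_{m+1}` (so that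
`‖v‖²_θ = ∑ₘ λ^{2θ(m+1)} v²_{m+1}`; `θ = γ` for the `γ`-energy, `θ = α + γ` for the dissipation),
the coupling terms `λ^{2γ(m+1)} v_{m+1}v_{m+2}` of the Lyapunov function `H`, the flux terms
`λ^{(1+2γ)(m+1)} v²_{m+1}v_{m+2}` and the cubic terms `λ^{(1+2γ)(m+1)} v³_{m+1}` of §5, and their
partial sums over `m < N` (written out in full: `∑ m ∈ Finset.range N, …`). -/


section summands

variable (hlam : 1 < lam)
include hlam

/-- **The `γ`-energy identity, termwise**: `λ^{2γn}·2uₙ·RHSₙ(u) = -2νλ^{2(α+γ)n}uₙ² +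
2λ^{2γn}λⁿu²ₙ₋₁uₙ - 2λ·λ^{(1+2γ)n}uₙ²uₙ₊₁ + 2λ^{2γn}gₙuₙ` (`n = m + 1`; the computation behind
(5.6) of the printed proof). [cite: Cheskidov2008, §5 proof of Thm. 5.3, (5.6)] -/
theorem e_summand_eq (v : ℕ → ℝ) (m : ℕ) :
    lam ^ (2 * γ * (m + 1 : ℕ)) * (2 * v (m + 1) * cheskidovRHS lam ν α g v (m + 1)) =
      -2 * ν * (lam ^ (2 * (α + γ) * (m + 1 : ℕ)) * v (m + 1) ^ 2) +
        2 * (lam ^ (2 * γ * (m + 1 : ℕ)) * lam ^ (m + 1) * (v m ^ 2 * v (m + 1))) -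
        2 * lam * (lam ^ ((1 + 2 * γ) * (m + 1 : ℕ)) * (v (m + 1) ^ 2 * v (m + 2))) + 2 *
            (lam ^ (2 * γ * (m + 1 : ℕ)) * (g (m + 1) * v (m + 1))) := by
  rw [cheskidovRHS_succ]
  linear_combination (-2 * ν * v (m + 1) ^ 2) * w_gamma_alpha (α := α) (γ := γ) hlam m +
    (-2 * (v (m + 1) ^ 2 * v (m + 2))) * w_gamma_npow (γ := γ) hlam m

/-- The input flux at mode `k + 2` is `λ^{1+2γ}` times the output flux term of mode `k + 1`:
`λ^{2γ(k+2)}λ^{k+2}u²ₖ₊₁uₖ₊₂ = λ^{1+2γ}·λ^{(1+2γ)(k+1)}u²ₖ₊₁uₖ₊₂` (this produces the constant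
`c₁ = λ^{2γ+1} - λ` of the printed proof). [cite: Cheskidov2008, §5 proof of Thm. 5.3] -/
theorem input_flux_eq (v : ℕ → ℝ) (k : ℕ) :
    lam ^ (2 * γ * (k + 1 + 1 : ℕ)) * lam ^ (k + 1 + 1) * (v (k + 1) ^ 2 * v (k + 1 + 1)) =
      lam ^ (1 + 2 * γ) * (lam ^ ((1 + 2 * γ) * (k + 1 : ℕ)) * (v (k + 1) ^ 2 * v (k + 2))) := by
  rw [show k + 1 + 1 = k + 2 from rfl, w_gamma_succ_npow (γ := γ) hlam k, mul_assoc]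

/-- **The coupling terms, termwise** (the differential inequality for `uₙuₙ₊₁` of the printed
proof, multiplied by `λ^{2γn}`, `n = m + 1`): for a non-negative state and non-negative force,
`λ^{2γn}(RHSₙ·uₙ₊₁ + uₙ·RHSₙ₊₁) ≥ -½ν(1+λ^{2α})(λ^{2(α+γ)n}uₙ² + λ^{2(α+γ)(n+1)}u²ₙ₊₁)
 - (2λ + ½λ²)λ^{(1+2γ)n}uₙ²uₙ₊₁ - λ·λ^{(1+2γ)(n+1)}u²ₙ₊₁uₙ₊₂ + λ·λ^{(1+2γ)n}uₙ³
 - ½λ^{(1+2γ)(n+1)}u³ₙ₊₁ - ¼λ^{(1+2γ)(n+2)}u³ₙ₊₂`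
(the printed coefficients `λ^{-2γ}/2`, `λ^{-4γ}/4`, `λ^{1-2γ}` are bounded by `1/2`, `1/4`, `λ`).
[cite: Cheskidov2008, §5 proof of Thm. 5.3, (5.3)–(5.5)] -/
theorem p_summand_lower (hα : 0 ≤ α) (hγ : 0 ≤ γ) (hν : 0 ≤ ν) (hg : ∀ n, 1 ≤ n → 0 ≤ g n)
    {v : ℕ → ℝ}
    (hv : ∀ n, 0 ≤ v n) (m : ℕ) :
    -(ν * (1 + lam ^ (2 * α)) / 2) *
          ((lam ^ (2 * (α + γ) * (m + 1 : ℕ)) * v (m + 1) ^ 2) +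
              lam ^ ((2 * (α + γ) : ℝ) * ((m + 2 : ℕ) : ℝ)) * v (m + 2) ^ 2) -
        (2 * lam + lam ^ 2 / 2) *
            (lam ^ ((1 + 2 * γ) * (m + 1 : ℕ)) * (v (m + 1) ^ 2 * v (m + 2))) -
        lam * (lam ^ ((1 + 2 * γ : ℝ) * ((m + 2 : ℕ) : ℝ)) * (v (m + 2) ^ 2 * v (m + 3))) +
        lam * (lam ^ ((1 + 2 * γ) * (m + 1 : ℕ)) * v (m + 1) ^ 3) -
            lam ^ ((1 + 2 * γ : ℝ) * ((m + 2 : ℕ) : ℝ)) * v (m + 2) ^ 3 / 2 -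
        lam ^ ((1 + 2 * γ : ℝ) * ((m + 3 : ℕ) : ℝ)) * v (m + 3) ^ 3 / 4 ≤
      lam ^ (2 * γ * (m + 1 : ℕ)) *
        (cheskidovRHS lam ν α g v (m + 1) * v (m + 2) +
          v (m + 1) * cheskidovRHS lam ν α g v (m + 2)) := by
  rw [cheskidovRHS_succ, cheskidovRHS_add_two]
  have hl : 0 ≤ lam := by linarith
  have ha := hv (m + 1)
  have hb := hv (m + 2)
  have hc := hv (m + 3)
  have hw : 0 ≤ lam ^ (2 * γ * (m + 1 : ℕ)) := Real.rpow_nonneg hl _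
  -- weights
  have h6 := w_gamma_alpha (α := α) (γ := γ) hlam m
  have h7 := w_gamma_alpha_succ (α := α) (γ := γ) hlam m
  have h1 := w_gamma_npow (γ := γ) hlam m
  have h1' := w_gamma_npow' (γ := γ) hlam m
  have h3 := w_gamma_npow_le_one (γ := γ) hlam hγ m
  have h4 := w_gamma_npow_le_two (γ := γ) hlam hγ m
  have h5 := w_gamma_npow_le_three (γ := γ) hlam hγ m
  have h8 := w_mono_succ hlam (θ := 2 * (α + γ)) (by positivity) m
  -- elementary
  have i1 := mul_sq_le_half_cube_add (v (m + 1)) hb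
  have i2 := mul_mul_le_of_nonneg (v (m + 1)) hb hc
  have i3 := two_mul_le_sq_add_sq (v (m + 1)) (v (m + 2))
  -- products
  have t1 : lam ^ (2 * γ * (m + 1 : ℕ)) * lam ^ (m + 2) * (v (m + 1) * v (m + 2) ^ 2) ≤
      lam ^ ((1 + 2 * γ : ℝ) * ((m + 2 : ℕ) : ℝ)) * (v (m + 2) ^ 3 / 2) +
        2 * lam * (lam ^ ((1 + 2 * γ : ℝ) * ((m + 1 : ℕ) : ℝ)) * (v (m + 1) ^ 2 * v (m + 2))) := by
    have e1 := mul_le_mul_of_nonneg_left i1 (mul_nonneg hw (pow_nonneg hl (m + 2)))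
    have e2 := mul_le_mul_of_nonneg_right h3 (by positivity : (0 : ℝ) ≤ v (m + 2) ^ 3 / 2)
    have e3 : lam ^ (2 * γ * (m + 1 : ℕ)) * lam ^ (m + 2) * (v (m + 1) ^ 2 * v (m + 2)) =
        lam * lam ^ ((1 + 2 * γ : ℝ) * ((m + 1 : ℕ) : ℝ)) * (v (m + 1) ^ 2 * v (m + 2)) := by
      rw [h1]
    linarith [e1, e2, e3]
  have t2 : lam ^ (2 * γ * (m + 1 : ℕ)) * lam ^ (m + 3) * (v (m + 1) * v (m + 2) * v (m + 3)) ≤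
      lam ^ 2 * (lam ^ ((1 + 2 * γ : ℝ) * ((m + 1 : ℕ) : ℝ)) * (v (m + 1) ^ 2 * v (m + 2))) / 2 +
        lam ^ ((1 + 2 * γ : ℝ) * ((m + 3 : ℕ) : ℝ)) * (v (m + 3) ^ 3 / 4) +
        lam * (lam ^ ((1 + 2 * γ : ℝ) * ((m + 2 : ℕ) : ℝ)) * (v (m + 2) ^ 2 * v (m + 3))) := by
    have e1 := mul_le_mul_of_nonneg_left i2 (mul_nonneg hw (pow_nonneg hl (m + 3)))
    have e2 := mul_le_mul_of_nonneg_right h4 (by positivity : (0 : ℝ) ≤ v (m + 3) ^ 3 / 4)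
    have e3 := mul_le_mul_of_nonneg_right h5
      (by positivity : (0 : ℝ) ≤ v (m + 2) ^ 2 * v (m + 3))
    have e4 : lam ^ (2 * γ * (m + 1 : ℕ)) * lam ^ (m + 3) * (v (m + 1) ^ 2 * v (m + 2) / 2) =
        lam ^ 2 * lam ^ ((1 + 2 * γ : ℝ) * ((m + 1 : ℕ) : ℝ)) * (v (m + 1) ^ 2 * v (m + 2) / 2) :=
            by
      rw [h1']
    linarith [e1, e2, e3, e4]
  have t3 : ν * (lam ^ (2 * γ * (m + 1 : ℕ)) * lam ^ (2 * α * (m + 1 : ℕ)) +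
        lam ^ (2 * γ * (m + 1 : ℕ)) * lam ^ (2 * α * (m + 2 : ℕ))) * (v (m + 1) * v (m + 2)) ≤
      ν * (1 + lam ^ (2 * α)) / 2 *
        ((lam ^ (2 * (α + γ) * (m + 1 : ℕ)) * v (m + 1) ^ 2) +
            lam ^ ((2 * (α + γ) : ℝ) * ((m + 2 : ℕ) : ℝ)) * v (m + 2) ^ 2) := by
    rw [h6, h7]
    have hwa : 0 ≤ lam ^ ((2 * (α + γ) : ℝ) * ((m + 1 : ℕ) : ℝ)) := Real.rpow_nonneg hl _
    have e1 := mul_le_mul_of_nonneg_left i3 hwa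
    have e2 := mul_le_mul_of_nonneg_right h8 (sq_nonneg (v (m + 2)))
    have hνc : 0 ≤ ν * (1 + lam ^ (2 * α)) / 2 := by positivity
    have e1' := mul_le_mul_of_nonneg_left e1 hνc
    have e2' := mul_le_mul_of_nonneg_left e2 hνc
    linarith [e1', e2']
  have t4 : lam ^ (2 * γ * (m + 1 : ℕ)) * lam ^ (m + 2) * v (m + 1) ^ 3 =
      lam * lam ^ ((1 + 2 * γ : ℝ) * ((m + 1 : ℕ) : ℝ)) * v (m + 1) ^ 3 := by
    rw [h1]
  have t5 : 0 ≤ lam ^ (2 * γ * (m + 1 : ℕ)) * lam ^ (m + 1) * (v m ^ 2 * v (m + 2)) := by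
    have := hv m; positivity
  have t6 : 0 ≤ lam ^ (2 * γ * (m + 1 : ℕ)) * (g (m + 1) * v (m + 2)) :=
    mul_nonneg hw (mul_nonneg (hg _ le_add_self) hb)
  have t7 : 0 ≤ lam ^ (2 * γ * (m + 1 : ℕ)) * (g (m + 2) * v (m + 1)) :=
    mul_nonneg hw (mul_nonneg (hg _ le_add_self) ha)
  linarith [t1, t2, t3, t4, t5, t6, t7]

end summands

/-! ## Partial sums over the modes `1, …, N` -/


section sums

/-- Shifting a sum of non-negative terms by one enlarges the range by one. [folklore] -/
theorem sum_shift_one_le {f : ℕ → ℝ} (hf : ∀ n, 0 ≤ f n) (N : ℕ) :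
    ∑ m ∈ Finset.range N, f (m + 2) ≤ ∑ m ∈ Finset.range (N + 1), f (m + 1) := by
  rw [Finset.sum_range_succ']
  have : ∑ m ∈ Finset.range N, f (m + 1 + 1) = ∑ m ∈ Finset.range N, f (m + 2) :=
    Finset.sum_congr rfl fun m _ => rfl
  linarith [hf (0 + 1)]

/-- Shifting a sum of non-negative terms by two enlarges the range by two. [folklore] -/
theorem sum_shift_two_le {f : ℕ → ℝ} (hf : ∀ n, 0 ≤ f n) (N : ℕ) :
    ∑ m ∈ Finset.range N, f (m + 3) ≤ ∑ m ∈ Finset.range (N + 2), f (m + 1) := by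
  have h1 := sum_shift_one_le (f := fun n => f (n + 1)) (fun n => hf _) N
  have h2 := sum_shift_one_le hf (N + 1)
  exact h1.trans h2

/-- Partial sums of non-negative terms increase with the range. [folklore] -/
theorem sum_range_le_sum_range_add {f : ℕ → ℝ} (hf : ∀ n, 0 ≤ f n) (N k : ℕ) :
    ∑ m ∈ Finset.range N, f m ≤ ∑ m ∈ Finset.range (N + k), f m :=
  Finset.sum_le_sum_of_subset_of_nonneg (Finset.range_subset_range.2 (Nat.le_add_right N k))
    fun m _ _ => hf m

variable (hlam : 1 < lam)
include hlam

/-- **Lower bound for the derivative of the truncated `γ`-energy**: summing `e_summand_eq`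
over `n ≤ N + 1`, re-indexing the input flux (which vanishes at `n = 1` since `u₀ = 0`) and
dropping the non-negative forcing, `d/dt ∑_{n≤N+1} λ^{2γn}uₙ² ≥ -2ν D_{N+1} + 2λ^{1+2γ}F_N -
2λF_{N+1}` — the truncated form of (5.6) with the flux constant `c₁ = λ^{2γ+1} - λ`.
[cite: Cheskidov2008, §5 proof of Thm. 5.3, (5.6)] -/
theorem e_sum_lower (hg : ∀ n, 1 ≤ n → 0 ≤ g n) {v : ℕ → ℝ} (hv0 : v 0 = 0)
    (hv : ∀ n, 0 ≤ v n) (N : ℕ) :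
    -2 * ν * (∑ m ∈ Finset.range (N + 1), lam ^ (2 * (α + γ) * (m + 1 : ℕ)) * v (m + 1) ^ 2) + 2 *
        lam ^ (1 + 2 * γ) *
        (∑ m ∈ Finset.range N, lam ^ ((1 + 2 * γ) * (m + 1 : ℕ)) * (v (m + 1) ^ 2 * v (m + 2))) -
        2 * lam * (∑ m ∈ Finset.range (N + 1), lam ^ ((1 + 2 * γ) * (m + 1 : ℕ)) *
        (v (m + 1) ^ 2 * v (m + 2))) ≤
      (∑ m ∈ Finset.range (N + 1), lam ^ (2 * γ * (m + 1 : ℕ)) *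
          (2 * v (m + 1) * cheskidovRHS lam ν α g v (m + 1))) := by
  have hl : 0 ≤ lam := by linarith
  rw [Finset.sum_congr rfl fun m _ => e_summand_eq (ν := ν) (α := α) (γ := γ) (g := g) hlam v m]
  rw [Finset.sum_add_distrib, Finset.sum_sub_distrib, Finset.sum_add_distrib, ← Finset.mul_sum,
    ← Finset.mul_sum, ← Finset.mul_sum, ← Finset.mul_sum]
  have hX : ∑ m ∈ Finset.range (N + 1),
      lam ^ (2 * γ * (m + 1 : ℕ)) * lam ^ (m + 1) * (v m ^ 2 * v (m + 1)) =
        lam ^ (1 + 2 * γ) *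
            (∑ m ∈ Finset.range N, lam ^ ((1 + 2 * γ) * (m + 1 : ℕ)) * (v (m + 1) ^ 2 * v (m + 2)))
            := by
    rw [Finset.sum_range_succ', hv0, Finset.mul_sum]
    simp only [ne_eq, OfNat.ofNat_ne_zero, not_false_eq_true, zero_pow, zero_mul, mul_zero,
      add_zero]
    exact Finset.sum_congr rfl fun k _ => input_flux_eq (γ := γ) hlam v k
  have hY : 0 ≤ ∑ m ∈ Finset.range (N + 1),
      lam ^ (2 * γ * (m + 1 : ℕ)) * (g (m + 1) * v (m + 1)) :=
    Finset.sum_nonneg fun m _ =>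
      mul_nonneg (Real.rpow_nonneg hl _) (mul_nonneg (hg _ le_add_self) (hv _))
  rw [hX]
  linarith

/-- **Lower bound for the derivative of the truncated coupling sum**: summing
`p_summand_lower` over `n ≤ N` and collecting shifted sums,
`d/dt ∑_{n≤N} λ^{2γn}uₙuₙ₊₁ ≥ -ν(1+λ^{2α})D_{N+1} - (3λ + λ²/2)F_{N+1} + λG_N - ½G_{N+1} - ¼G_{N+2}`
— the truncated form of (5.5). [cite: Cheskidov2008, §5 proof of Thm. 5.3, (5.5)] -/
theorem p_sum_lower (hα : 0 ≤ α) (hγ : 0 ≤ γ) (hν : 0 ≤ ν) (hg : ∀ n, 1 ≤ n → 0 ≤ g n)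
    {v : ℕ → ℝ} (hv : ∀ n, 0 ≤ v n) (N : ℕ) :
    -(ν * (1 + lam ^ (2 * α))) *
        (∑ m ∈ Finset.range (N + 1), lam ^ (2 * (α + γ) * (m + 1 : ℕ)) * v (m + 1) ^ 2) -
        (3 * lam + lam ^ 2 / 2) *
        (∑ m ∈ Finset.range (N + 1), lam ^ ((1 + 2 * γ) * (m + 1 : ℕ)) *
        (v (m + 1) ^ 2 * v (m + 2))) +
        lam * (∑ m ∈ Finset.range N, lam ^ ((1 + 2 * γ) * (m + 1 : ℕ)) * v (m + 1) ^ 3) -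
            (∑ m ∈ Finset.range (N + 1), lam ^ ((1 + 2 * γ) * (m + 1 : ℕ)) * v (m + 1) ^ 3) / 2 -
            (∑ m ∈ Finset.range (N + 2), lam ^ ((1 + 2 * γ) * (m + 1 : ℕ)) * v (m + 1) ^ 3) / 4 ≤
            (∑ m ∈ Finset.range N, lam ^ (2 * γ * (m + 1 : ℕ)) *
            (cheskidovRHS lam ν α g v (m + 1) * v (m + 2) + v (m + 1) *
            cheskidovRHS lam ν α g v (m + 2))) := by
  have hl : 0 ≤ lam := by linarith
  have hsum := Finset.sum_le_sum fun m (_ : m ∈ Finset.range N) =>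
    p_summand_lower (ν := ν) (α := α) (γ := γ) (g := g) hlam hα hγ hν hg hv m
  refine le_trans ?_ hsum
  rw [Finset.sum_sub_distrib, Finset.sum_sub_distrib, Finset.sum_add_distrib,
    Finset.sum_sub_distrib, Finset.sum_sub_distrib, ← Finset.mul_sum, ← Finset.mul_sum,
    ← Finset.mul_sum, ← Finset.mul_sum, Finset.sum_add_distrib, ← Finset.sum_div,
    ← Finset.sum_div]
  -- non-negativity of the terms
  have hwE : ∀ n, 0 ≤ lam ^ ((2 * (α + γ) : ℝ) * ((n : ℕ) : ℝ)) * v n ^ 2 := fun n =>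
    mul_nonneg (Real.rpow_nonneg hl _) (sq_nonneg _)
  have hfT : ∀ n, 0 ≤ lam ^ ((1 + 2 * γ : ℝ) * ((n : ℕ) : ℝ)) * (v n ^ 2 * v (n + 1)) := fun n =>
    mul_nonneg (Real.rpow_nonneg hl _) (mul_nonneg (sq_nonneg _) (hv _))
  have hgT : ∀ n, 0 ≤ lam ^ ((1 + 2 * γ : ℝ) * ((n : ℕ) : ℝ)) * v n ^ 3 := fun n =>
    mul_nonneg (Real.rpow_nonneg hl _) (pow_nonneg (hv _) 3)
  -- shifted sums
  have s1 := sum_shift_one_le hwE N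
  have s2 := sum_range_le_sum_range_add (fun m => hwE (m + 1)) N 1
  have s3 := sum_shift_one_le hfT N
  have s4 := sum_range_le_sum_range_add (fun m => hfT (m + 1)) N 1
  have s5 := sum_shift_one_le hgT N
  have s6 := sum_shift_two_le hgT N
  have hc : 0 ≤ ν * (1 + lam ^ (2 * α)) := by positivity
  have hl2 : 0 ≤ 2 * lam + lam ^ 2 / 2 := by positivity
  nlinarith [mul_le_mul_of_nonneg_left (add_le_add s2 s1) hc,
    mul_le_mul_of_nonneg_left s4 hl2, mul_le_mul_of_nonneg_left s3 hl, s5, s6]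

end sums

/-! ## Geometric sums of weights -/

/-- `∑_{m<N} r^{m+1} ≤ r/(1-r)` for `0 ≤ r < 1`. [folklore] -/
theorem geom_partial_le {r : ℝ} (hr0 : 0 ≤ r) (hr1 : r < 1) (N : ℕ) :
    ∑ m ∈ Finset.range N, r ^ (m + 1) ≤ r / (1 - r) := by
  have h1 : (∑ m ∈ Finset.range N, r ^ m) * (1 - r) = 1 - r ^ N := geom_sum_mul_neg r N
  have h2 : ∑ m ∈ Finset.range N, r ^ m ≤ 1 / (1 - r) := by
    rw [le_div_iff₀ (by linarith), h1]
    linarith [pow_nonneg hr0 N]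
  have h3 : ∑ m ∈ Finset.range N, r ^ (m + 1) = r * ∑ m ∈ Finset.range N, r ^ m := by
    rw [Finset.mul_sum]
    exact Finset.sum_congr rfl fun m _ => by ring
  rw [h3]
  calc r * ∑ m ∈ Finset.range N, r ^ m ≤ r * (1 / (1 - r)) :=
        mul_le_mul_of_nonneg_left h2 hr0
    _ = r / (1 - r) := by ring

/-- `λ^{-θ(m+1)} = (λ^{-θ})^{m+1}`. [folklore] -/
theorem rpow_neg_mul_natCast (hlam : 0 ≤ lam) (θ : ℝ) (m : ℕ) :
    lam ^ (-θ * (m + 1 : ℕ)) = (lam ^ (-θ)) ^ (m + 1) := by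
  rw [Real.rpow_mul hlam, Real.rpow_natCast]

/-- For `λ > 1` and `θ > 0`, `0 ≤ λ^{-θ} < 1`. [folklore] -/
theorem rpow_neg_lt_one (hlam : 1 < lam) {θ : ℝ} (hθ : 0 < θ) : lam ^ (-θ) < 1 :=
  Real.rpow_lt_one_of_one_lt_of_neg hlam (by linarith)

/-- `∑_{m<N} λ^{-θ(m+1)} ≤ λ^{-θ}/(1 - λ^{-θ})` for `λ > 1`, `θ > 0`. [folklore] -/
theorem sum_rpow_neg_le (hlam : 1 < lam) {θ : ℝ} (hθ : 0 < θ) (N : ℕ) :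
    ∑ m ∈ Finset.range N, lam ^ (-θ * (m + 1 : ℕ)) ≤ lam ^ (-θ) / (1 - lam ^ (-θ)) := by
  have hl : 0 ≤ lam := by linarith
  rw [Finset.sum_congr rfl fun m _ => rpow_neg_mul_natCast hl θ m]
  exact geom_partial_le (Real.rpow_nonneg hl _) (rpow_neg_lt_one hlam hθ) N

section threshold

variable (hlam : 1 < lam)
include hlam

/-- **The dissipation is dominated by the cubic terms up to a constant** (replacing the
printed "assume `H(τ) ≥ M²`" step): for `p ≥ 0`, `q > 0` and a non-negative state,
`p ∑ λ^{2(α+γ)n}uₙ² ≤ q ∑ λ^{(1+2γ)n}uₙ³ + (p³/q²)·λ^{-ε}/(1-λ^{-ε})` with `ε = 2 - 6α - 2γ > 0`,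
termwise from `p'x² ≤ q'x³ + p'³/q'²` and `(λ^{2(α+γ)n})³/(λ^{(1+2γ)n})² = λ^{-εn}`.
[cite: Cheskidov2008, §5 proof of Thm. 5.3 and Lemma 5.1] -/
theorem dissipation_le (hε : 0 < 2 - 6 * α - 2 * γ) {p q : ℝ} (hp : 0 ≤ p) (hq : 0 < q)
    {v : ℕ → ℝ} (hv : ∀ n, 0 ≤ v n) (N : ℕ) :
    p * (∑ m ∈ Finset.range N, lam ^ (2 * (α + γ) * (m + 1 : ℕ)) * v (m + 1) ^ 2) ≤ q *
        (∑ m ∈ Finset.range N, lam ^ ((1 + 2 * γ) * (m + 1 : ℕ)) * v (m + 1) ^ 3) +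
      p ^ 3 / q ^ 2 * (lam ^ (-(2 - 6 * α - 2 * γ)) / (1 - lam ^ (-(2 - 6 * α - 2 * γ)))) := by
  have hl : 0 < lam := by linarith
  have hterm : ∀ m : ℕ, p * (lam ^ (2 * (α + γ) * (m + 1 : ℕ)) * v (m + 1) ^ 2) ≤ q *
      (lam ^ ((1 + 2 * γ) * (m + 1 : ℕ)) * v (m + 1) ^ 3) +
      p ^ 3 / q ^ 2 * lam ^ (-(2 - 6 * α - 2 * γ) * (m + 1 : ℕ)) := by
    intro m
    have hW1 : 0 < lam ^ ((2 * (α + γ) : ℝ) * ((m + 1 : ℕ) : ℝ)) := Real.rpow_pos_of_pos hl _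
    have hW2 : 0 < lam ^ ((1 + 2 * γ : ℝ) * ((m + 1 : ℕ) : ℝ)) := Real.rpow_pos_of_pos hl _
    have h := sq_le_cube_add_const (mul_nonneg hp hW1.le) (mul_pos hq hW2) (hv (m + 1))
    have hid : (p * lam ^ ((2 * (α + γ) : ℝ) * ((m + 1 : ℕ) : ℝ))) ^ 3 /
        (q * lam ^ ((1 + 2 * γ : ℝ) * ((m + 1 : ℕ) : ℝ))) ^ 2 =
          p ^ 3 / q ^ 2 * lam ^ (-(2 - 6 * α - 2 * γ) * (m + 1 : ℕ)) := by
      rw [mul_pow, mul_pow, ← Real.rpow_natCast (lam ^ ((2 * (α + γ) : ℝ) * ((m + 1 : ℕ) : ℝ))) 3,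
        ← Real.rpow_natCast (lam ^ ((1 + 2 * γ : ℝ) * ((m + 1 : ℕ) : ℝ))) 2,
        ← Real.rpow_mul hl.le, ← Real.rpow_mul hl.le, mul_div_mul_comm, ← Real.rpow_sub hl]
      congr 1
      push_cast
      ring_nf
    rw [hid] at h
    linarith
  have hsum := Finset.sum_le_sum fun m (_ : m ∈ Finset.range N) => hterm m
  rw [← Finset.mul_sum, Finset.sum_add_distrib, ← Finset.mul_sum, ← Finset.mul_sum] at hsum
  have hgeo := sum_rpow_neg_le hlam hε N
  have hpq : 0 ≤ p ^ 3 / q ^ 2 := by positivity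
  nlinarith [mul_le_mul_of_nonneg_left hgeo hpq]

/-- **The truncated Lyapunov inequality for states.** With `c₁ = λ^{1+2γ} - λ`,
`c₂(3λ + λ²/2) = 2c₁`, `c = c₂(λ - 3/4)`, `p = ν(2 + c₂(1+λ^{2α}))` and the constant `K'` of
`dissipation_le` (with `q = c/2`), the derivative `h_N = e_{N+1} + c₂p_N` of the truncated
Lyapunov function `H_N = ∑_{n≤N+1}λ^{2γn}uₙ² + c₂∑_{n≤N}λ^{2γn}uₙuₙ₊₁` along (3.1) satisfies, at
every non-negative state with `u₀ = 0`,
`h_N ≥ (c/2)∑_{n≤N}λ^{(1+2γ)n}uₙ³ - K' - R_N`, where the remainder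
`R_N = (c/2 + 3c₂/4)λ^{(1+2γ)(N+1)}u³_{N+1} + (c₂/4)λ^{(1+2γ)(N+2)}u³_{N+2}
  + 2λ^{1+2γ}λ^{(1+2γ)(N+1)}u²_{N+1}u_{N+2}`
consists of single terms of convergent series (the truncated form of
`½ dH/dt ≳ -ν‖u‖²_{α+γ} + ‖u‖³_{α+γ}`). [cite: Cheskidov2008, §5 proof of Thm. 5.3, (5.5)–(5.7)] -/
theorem lyapunov_deriv_lower (hα : 0 ≤ α) (hγ : 0 ≤ γ) (hν : 0 ≤ ν)
    (hε : 0 < 2 - 6 * α - 2 * γ) (hg : ∀ n, 1 ≤ n → 0 ≤ g n) {c₂ : ℝ} (hc₂ : 0 ≤ c₂)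
    (hK : c₂ * (3 * lam + lam ^ 2 / 2) = 2 * (lam ^ (1 + 2 * γ) - lam))
    (hc : 0 < c₂ * (lam - 3 / 4)) {v : ℕ → ℝ} (hv0 : v 0 = 0) (hv : ∀ n, 0 ≤ v n) (N : ℕ) :
    c₂ * (lam - 3 / 4) / 2 *
        (∑ m ∈ Finset.range N, lam ^ ((1 + 2 * γ) * (m + 1 : ℕ)) * v (m + 1) ^ 3) -
        (ν * (2 + c₂ * (1 + lam ^ (2 * α)))) ^ 3 / (c₂ * (lam - 3 / 4) / 2) ^ 2 *
          (lam ^ (-(2 - 6 * α - 2 * γ)) / (1 - lam ^ (-(2 - 6 * α - 2 * γ)))) -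
        ((c₂ * (lam - 3 / 4) / 2 + 3 * c₂ / 4) *
            (lam ^ ((1 + 2 * γ) * (N + 1 : ℕ)) * v (N + 1) ^ 3) +
          c₂ / 4 * (lam ^ ((1 + 2 * γ : ℝ) * ((N + 2 : ℕ) : ℝ)) * v (N + 2) ^ 3) +
          2 * lam ^ (1 + 2 * γ) *
              (lam ^ ((1 + 2 * γ) * (N + 1 : ℕ)) * (v (N + 1) ^ 2 * v (N + 2)))) ≤
      (∑ m ∈ Finset.range (N + 1), lam ^ (2 * γ * (m + 1 : ℕ)) *
          (2 * v (m + 1) * cheskidovRHS lam ν α g v (m + 1))) + c₂ *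
          (∑ m ∈ Finset.range N, lam ^ (2 * γ * (m + 1 : ℕ)) *
          (cheskidovRHS lam ν α g v (m + 1) * v (m + 2) + v (m + 1) *
          cheskidovRHS lam ν α g v (m + 2))) := by
  have he := e_sum_lower (ν := ν) (α := α) (γ := γ) hlam hg hv0 hv N
  have hp := mul_le_mul_of_nonneg_left (p_sum_lower (γ := γ) hlam hα hγ hν hg hv N) hc₂
  have hd := dissipation_le (α := α) (γ := γ) hlam hε
    (p := ν * (2 + c₂ * (1 + lam ^ (2 * α)))) (q := c₂ * (lam - 3 / 4) / 2) (by positivity)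
        (by positivity) hv (N + 1)
  have hF : (∑ m ∈ Finset.range (N + 1), lam ^ ((1 + 2 * γ) * (m + 1 : ℕ)) *
      (v (m + 1) ^ 2 * v (m + 2))) =
      (∑ m ∈ Finset.range N, lam ^ ((1 + 2 * γ) * (m + 1 : ℕ)) * (v (m + 1) ^ 2 * v (m + 2))) +
      (lam ^ ((1 + 2 * γ) * (N + 1 : ℕ)) * (v (N + 1) ^ 2 * v (N + 2))) := Finset.sum_range_succ _ _
  have hG1 : (∑ m ∈ Finset.range (N + 1), lam ^ ((1 + 2 * γ) * (m + 1 : ℕ)) * v (m + 1) ^ 3) =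
      (∑ m ∈ Finset.range N, lam ^ ((1 + 2 * γ) * (m + 1 : ℕ)) * v (m + 1) ^ 3) +
      (lam ^ ((1 + 2 * γ) * (N + 1 : ℕ)) * v (N + 1) ^ 3) := Finset.sum_range_succ _ _
  have hG2 : (∑ m ∈ Finset.range (N + 2), lam ^ ((1 + 2 * γ) * (m + 1 : ℕ)) * v (m + 1) ^ 3) =
      (∑ m ∈ Finset.range N, lam ^ ((1 + 2 * γ) * (m + 1 : ℕ)) * v (m + 1) ^ 3) +
      (lam ^ ((1 + 2 * γ) * (N + 1 : ℕ)) * v (N + 1) ^ 3) +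
      lam ^ ((1 + 2 * γ : ℝ) * ((N + 2 : ℕ) : ℝ)) * v (N + 2) ^ 3 := by
    rw [Finset.sum_range_succ, Finset.sum_range_succ]
  have hKF : c₂ * (3 * lam + lam ^ 2 / 2) *
      (∑ m ∈ Finset.range (N + 1), lam ^ ((1 + 2 * γ) * (m + 1 : ℕ)) * (v (m + 1) ^ 2 * v (m + 2)))
      =
      2 * (lam ^ (1 + 2 * γ) - lam) *
          (∑ m ∈ Finset.range (N + 1), lam ^ ((1 + 2 * γ) * (m + 1 : ℕ)) *
          (v (m + 1) ^ 2 * v (m + 2))) := by rw [hK]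
  have hLF : lam ^ (1 + 2 * γ) *
      (∑ m ∈ Finset.range (N + 1), lam ^ ((1 + 2 * γ) * (m + 1 : ℕ)) * (v (m + 1) ^ 2 * v (m + 2)))
      =
      lam ^ (1 + 2 * γ) *
          (∑ m ∈ Finset.range N, lam ^ ((1 + 2 * γ) * (m + 1 : ℕ)) * (v (m + 1) ^ 2 * v (m + 2))) +
          lam ^ (1 + 2 * γ) * (lam ^ ((1 + 2 * γ) * (N + 1 : ℕ)) * (v (N + 1) ^ 2 * v (N + 2))) :=
          by rw [hF, mul_add]
  have hlF : lam *
      (∑ m ∈ Finset.range (N + 1), lam ^ ((1 + 2 * γ) * (m + 1 : ℕ)) * (v (m + 1) ^ 2 * v (m + 2)))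
      = lam * (∑ m ∈ Finset.range N, lam ^ ((1 + 2 * γ) * (m + 1 : ℕ)) *
      (v (m + 1) ^ 2 * v (m + 2))) + lam *
      (lam ^ ((1 + 2 * γ) * (N + 1 : ℕ)) * (v (N + 1) ^ 2 * v (N + 2))) := by rw [hF, mul_add]
  have hcG1 : c₂ *
      (∑ m ∈ Finset.range (N + 1), lam ^ ((1 + 2 * γ) * (m + 1 : ℕ)) * v (m + 1) ^ 3) = c₂ *
      (∑ m ∈ Finset.range N, lam ^ ((1 + 2 * γ) * (m + 1 : ℕ)) * v (m + 1) ^ 3) + c₂ *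
      (lam ^ ((1 + 2 * γ) * (N + 1 : ℕ)) * v (N + 1) ^ 3) := by rw [hG1, mul_add]
  have hcG2 : c₂ *
      (∑ m ∈ Finset.range (N + 2), lam ^ ((1 + 2 * γ) * (m + 1 : ℕ)) * v (m + 1) ^ 3) = c₂ *
      (∑ m ∈ Finset.range N, lam ^ ((1 + 2 * γ) * (m + 1 : ℕ)) * v (m + 1) ^ 3) + c₂ *
      (lam ^ ((1 + 2 * γ) * (N + 1 : ℕ)) * v (N + 1) ^ 3) +
      c₂ * (lam ^ ((1 + 2 * γ : ℝ) * ((N + 2 : ℕ) : ℝ)) * v (N + 2) ^ 3) := by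
    rw [hG2, mul_add, mul_add]
  have hqG1 : c₂ * (lam - 3 / 4) / 2 *
      (∑ m ∈ Finset.range (N + 1), lam ^ ((1 + 2 * γ) * (m + 1 : ℕ)) * v (m + 1) ^ 3) =
      c₂ * (lam - 3 / 4) / 2 *
          (∑ m ∈ Finset.range N, lam ^ ((1 + 2 * γ) * (m + 1 : ℕ)) * v (m + 1) ^ 3) + c₂ *
          (lam - 3 / 4) / 2 * (lam ^ ((1 + 2 * γ) * (N + 1 : ℕ)) * v (N + 1) ^ 3) := by
    rw [hG1, mul_add]
  linarith [he, hp, hd, hKF, hLF, hlF, hcG1, hcG2, hqG1]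

end threshold

section holder

variable (hlam : 1 < lam)
include hlam

/-- The coupling sum is dominated by the `γ`-energy: `∑_{n≤N}λ^{2γn}uₙuₙ₊₁ ≤ ∑_{n≤N+1}λ^{2γn}uₙ²`
(Cauchy–Schwarz, as in Lemma 5.2 and in `‖u‖²_γ ≤ H ≤ (1+c₂)‖u‖²_γ`).
[cite: Cheskidov2008, §5 Lemma 5.2 and proof of Thm. 5.3] -/
theorem coupling_sum_le (hγ : 0 ≤ γ) (v : ℕ → ℝ) (N : ℕ) :
    (∑ m ∈ Finset.range N, lam ^ (2 * γ * (m + 1 : ℕ)) * (v (m + 1) * v (m + 2))) ≤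
        (∑ m ∈ Finset.range (N + 1), lam ^ (2 * γ * (m + 1 : ℕ)) * v (m + 1) ^ 2) := by
  have hl : 0 ≤ lam := by linarith
  have hterm : ∀ m : ℕ, (lam ^ (2 * γ * (m + 1 : ℕ)) * (v (m + 1) * v (m + 2))) ≤
      ((lam ^ (2 * γ * (m + 1 : ℕ)) * v (m + 1) ^ 2) + lam ^ ((2 * γ : ℝ) * ((m + 2 : ℕ) : ℝ)) *
          v (m + 2) ^ 2) / 2 := by
    intro m
    have hw : 0 ≤ lam ^ ((2 * γ : ℝ) * ((m + 1 : ℕ) : ℝ)) := Real.rpow_nonneg hl _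
    have h1 := mul_le_mul_of_nonneg_left (two_mul_le_sq_add_sq (v (m + 1)) (v (m + 2))) hw
    have h2 := mul_le_mul_of_nonneg_right (w_mono_succ hlam (θ := 2 * γ) (by positivity) m)
      (sq_nonneg (v (m + 2)))
    linarith
  have hwE : ∀ n, 0 ≤ lam ^ ((2 * γ : ℝ) * ((n : ℕ) : ℝ)) * v n ^ 2 := fun n =>
    mul_nonneg (Real.rpow_nonneg hl _) (sq_nonneg _)
  have hsum := Finset.sum_le_sum fun m (_ : m ∈ Finset.range N) => hterm m
  rw [← Finset.sum_div, Finset.sum_add_distrib] at hsum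
  have s1 := sum_shift_one_le hwE N
  have s2 := sum_range_le_sum_range_add (fun m => hwE (m + 1)) N 1
  linarith

/-- **Lemma 5.1 (Hölder), energy form**: for a non-negative state and `γ < 1`,
`(∑_{n≤N} λ^{2γn}uₙ²)³ ≤ S·(∑_{n≤N} λ^{(1+2γ)n}uₙ³)²` with `S = λ^{-2(1-γ)}/(1 - λ^{-2(1-γ)})`
(Hölder with `p = 3`, `q = 3/2` applied to `λ^{2γn}uₙ² = λ^{-⅔(1-γ)n} · λ^{⅔(1+2γ)n}uₙ²`, exactly
as in the printed proof of Lemma 5.1 with `α + γ` replaced by `γ`).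
[cite: Cheskidov2008, §5 Lemma 5.1] -/
theorem energy_cube_le (hγ1 : γ < 1) {v : ℕ → ℝ} (hv : ∀ n, 0 ≤ v n) (N : ℕ) :
    (∑ m ∈ Finset.range N, lam ^ (2 * γ * (m + 1 : ℕ)) * v (m + 1) ^ 2) ^ 3 ≤
        lam ^ (-(2 * (1 - γ))) / (1 - lam ^ (-(2 * (1 - γ)))) *
        (∑ m ∈ Finset.range N, lam ^ ((1 + 2 * γ) * (m + 1 : ℕ)) * v (m + 1) ^ 3) ^ 2 := by
  have hl : 0 < lam := by linarith
  set f : ℕ → ℝ := fun m => lam ^ ((-(2 * (1 - γ)) / 3) * ((m + 1 : ℕ) : ℝ)) with hf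
  set g' : ℕ → ℝ := fun m =>
    lam ^ (((2 / 3) * (1 + 2 * γ)) * ((m + 1 : ℕ) : ℝ)) * v (m + 1) ^ 2 with hg'
  have hf0 : ∀ m, 0 ≤ f m := fun m => Real.rpow_nonneg hl.le _
  have hg0 : ∀ m, 0 ≤ g' m := fun m => mul_nonneg (Real.rpow_nonneg hl.le _) (sq_nonneg _)
  have hpq : (3 : ℝ).HolderConjugate (3 / 2) :=
    Real.holderConjugate_iff.mpr ⟨by norm_num, by norm_num⟩
  have hH := Real.inner_le_Lp_mul_Lq_of_nonneg (f := f) (g := g') (Finset.range N) hpq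
    (fun m _ => hf0 m) (fun m _ => hg0 m)
  have hfg : ∀ m, f m * g' m = (lam ^ (2 * γ * (m + 1 : ℕ)) * v (m + 1) ^ 2) := by
    intro m
    simp only [hf, hg']
    rw [← mul_assoc, rpow_mul_rpow_eq hl rfl]
    congr 2
    ring
  have hf3 : ∀ m, f m ^ (3 : ℝ) = lam ^ (-(2 * (1 - γ)) * (m + 1 : ℕ)) := by
    intro m
    simp only [hf]
    rw [← Real.rpow_mul hl.le]
    congr 1
    ring
  have hg3 : ∀ m, g' m ^ (3 / 2 : ℝ) = (lam ^ ((1 + 2 * γ) * (m + 1 : ℕ)) * v (m + 1) ^ 3) := by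
    intro m
    simp only [hg']
    have e1 : (lam ^ (((2 / 3) * (1 + 2 * γ)) * ((m + 1 : ℕ) : ℝ))) ^ (3 / 2 : ℝ) =
        lam ^ ((1 + 2 * γ : ℝ) * ((m + 1 : ℕ) : ℝ)) := by
      rw [← Real.rpow_mul hl.le]
      congr 1
      ring
    have e2 : (v (m + 1) ^ 2) ^ (3 / 2 : ℝ) = v (m + 1) ^ 3 := by
      rw [← Real.rpow_natCast (v (m + 1)) 2, ← Real.rpow_mul (hv _),
        ← Real.rpow_natCast (v (m + 1)) 3]
      congr 1
      norm_num
    rw [Real.mul_rpow (Real.rpow_nonneg hl.le _) (sq_nonneg _), e1, e2]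
  rw [Finset.sum_congr rfl fun m _ => hfg m, Finset.sum_congr rfl fun m _ => hf3 m,
    Finset.sum_congr rfl fun m _ => hg3 m] at hH
  set A := ∑ m ∈ Finset.range N, lam ^ (-(2 * (1 - γ)) * (m + 1 : ℕ)) with hA
  have hA0 : 0 ≤ A := Finset.sum_nonneg fun m _ => Real.rpow_nonneg hl.le _
  have hAS : A ≤ lam ^ (-(2 * (1 - γ))) / (1 - lam ^ (-(2 * (1 - γ)))) :=
    sum_rpow_neg_le hlam (by linarith) N
  have hG0 : 0 ≤ (∑ m ∈ Finset.range N, lam ^ ((1 + 2 * γ) * (m + 1 : ℕ)) * v (m + 1) ^ 3) :=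
    Finset.sum_nonneg fun m _ => mul_nonneg (Real.rpow_nonneg hl.le _) (pow_nonneg (hv _) 3)
  have hE0 : 0 ≤ (∑ m ∈ Finset.range N, lam ^ (2 * γ * (m + 1 : ℕ)) * v (m + 1) ^ 2) :=
    Finset.sum_nonneg fun m _ => mul_nonneg (Real.rpow_nonneg hl.le _) (sq_nonneg _)
  have hcube := pow_le_pow_left₀ hE0 hH 3
  have hA3 : (A ^ (1 / (3 : ℝ))) ^ 3 = A := by
    rw [← Real.rpow_natCast _ 3, ← Real.rpow_mul hA0]
    norm_num
  have hG3 : ((∑ m ∈ Finset.range N, lam ^ ((1 + 2 * γ) * (m + 1 : ℕ)) * v (m + 1) ^ 3) ^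
      (1 / (3 / 2 : ℝ))) ^ 3 =
      (∑ m ∈ Finset.range N, lam ^ ((1 + 2 * γ) * (m + 1 : ℕ)) * v (m + 1) ^ 3) ^ 2 := by
    rw [← Real.rpow_natCast _ 3, ← Real.rpow_mul hG0, ← Real.rpow_natCast _ 2]
    norm_num
  rw [mul_pow, hA3, hG3] at hcube
  calc (∑ m ∈ Finset.range N, lam ^ (2 * γ * (m + 1 : ℕ)) * v (m + 1) ^ 2) ^ 3 ≤ A *
          (∑ m ∈ Finset.range N, lam ^ ((1 + 2 * γ) * (m + 1 : ℕ)) * v (m + 1) ^ 3) ^ 2 := hcube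
    _ ≤ _ := mul_le_mul_of_nonneg_right hAS (sq_nonneg _)

/-- **`H^{3/2}` is dominated by the cubic sum**: with `H_N = ∑_{n≤N+1}λ^{2γn}uₙ² +
c₂∑_{n≤N}λ^{2γn}uₙuₙ₊₁ ≤ (1+c₂)‖u‖²_γ` and `energy_cube_le`,
`H_N^{3/2} ≤ √((1+c₂)³S) · ∑_{n≤N+1}λ^{(1+2γ)n}uₙ³` (the step `‖u‖_{α+γ} ≥ √(H/(1+c₂))` combined
with Lemma 5.1 in the printed proof). [cite: Cheskidov2008, §5 proof of Thm. 5.3, (5.7)] -/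
theorem lyapunov_rpow_le (hγ : 0 ≤ γ) (hγ1 : γ < 1) {c₂ : ℝ} (hc₂ : 0 ≤ c₂) {v : ℕ → ℝ}
    (hv : ∀ n, 0 ≤ v n) (N : ℕ) :
    ((∑ m ∈ Finset.range (N + 1), lam ^ (2 * γ * (m + 1 : ℕ)) * v (m + 1) ^ 2) + c₂ *
        (∑ m ∈ Finset.range N, lam ^ (2 * γ * (m + 1 : ℕ)) * (v (m + 1) * v (m + 2)))) ^
        (3 / 2 : ℝ) ≤
      Real.sqrt ((1 + c₂) ^ 3 * (lam ^ (-(2 * (1 - γ))) / (1 - lam ^ (-(2 * (1 - γ)))))) *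
        (∑ m ∈ Finset.range (N + 1), lam ^ ((1 + 2 * γ) * (m + 1 : ℕ)) * v (m + 1) ^ 3) := by
  have hl : 0 < lam := by linarith
  have hPS := coupling_sum_le (γ := γ) hlam hγ v N
  have hE0 : 0 ≤ (∑ m ∈ Finset.range (N + 1), lam ^ (2 * γ * (m + 1 : ℕ)) * v (m + 1) ^ 2) :=
    Finset.sum_nonneg fun m _ => mul_nonneg (Real.rpow_nonneg hl.le _) (sq_nonneg _)
  have hP0 : 0 ≤ (∑ m ∈ Finset.range N, lam ^ (2 * γ * (m + 1 : ℕ)) * (v (m + 1) * v (m + 2))) :=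
    Finset.sum_nonneg fun m _ => mul_nonneg (Real.rpow_nonneg hl.le _) (mul_nonneg (hv _) (hv _))
  have hG0 : 0 ≤ (∑ m ∈ Finset.range (N + 1), lam ^ ((1 + 2 * γ) * (m + 1 : ℕ)) * v (m + 1) ^ 3) :=
    Finset.sum_nonneg fun m _ => mul_nonneg (Real.rpow_nonneg hl.le _) (pow_nonneg (hv _) 3)
  have hH0 : 0 ≤ (∑ m ∈ Finset.range (N + 1), lam ^ (2 * γ * (m + 1 : ℕ)) * v (m + 1) ^ 2) + c₂ *
      (∑ m ∈ Finset.range N, lam ^ (2 * γ * (m + 1 : ℕ)) * (v (m + 1) * v (m + 2))) := by positivity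
  have hHle : (∑ m ∈ Finset.range (N + 1), lam ^ (2 * γ * (m + 1 : ℕ)) * v (m + 1) ^ 2) + c₂ *
      (∑ m ∈ Finset.range N, lam ^ (2 * γ * (m + 1 : ℕ)) * (v (m + 1) * v (m + 2))) ≤ (1 + c₂) *
      (∑ m ∈ Finset.range (N + 1), lam ^ (2 * γ * (m + 1 : ℕ)) * v (m + 1) ^ 2) := by nlinarith
  have hcube := energy_cube_le (γ := γ) hlam hγ1 hv (N + 1)
  set S := lam ^ (-(2 * (1 - γ))) / (1 - lam ^ (-(2 * (1 - γ)))) with hS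
  have hS0 : 0 ≤ S := by
    have h1 : lam ^ (-(2 * (1 - γ))) < 1 := rpow_neg_lt_one hlam (by linarith)
    have h2 : 0 ≤ lam ^ (-(2 * (1 - γ))) := Real.rpow_nonneg hl.le _
    exact div_nonneg h2 (by linarith)
  have h3 : ((∑ m ∈ Finset.range (N + 1), lam ^ (2 * γ * (m + 1 : ℕ)) * v (m + 1) ^ 2) + c₂ *
      (∑ m ∈ Finset.range N, lam ^ (2 * γ * (m + 1 : ℕ)) * (v (m + 1) * v (m + 2)))) ^ 3 ≤
      (1 + c₂) ^ 3 * S *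
      (∑ m ∈ Finset.range (N + 1), lam ^ ((1 + 2 * γ) * (m + 1 : ℕ)) * v (m + 1) ^ 3) ^ 2 := by
    calc ((∑ m ∈ Finset.range (N + 1), lam ^ (2 * γ * (m + 1 : ℕ)) * v (m + 1) ^ 2) + c₂ *
            (∑ m ∈ Finset.range N, lam ^ (2 * γ * (m + 1 : ℕ)) * (v (m + 1) * v (m + 2)))) ^ 3 ≤
            ((1 + c₂) * (∑ m ∈ Finset.range (N + 1), lam ^ (2 * γ * (m + 1 : ℕ)) * v (m + 1) ^ 2))
            ^ 3 :=
          pow_le_pow_left₀ hH0 hHle 3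
      _ = (1 + c₂) ^ 3 *
          (∑ m ∈ Finset.range (N + 1), lam ^ (2 * γ * (m + 1 : ℕ)) * v (m + 1) ^ 2) ^ 3 := by ring
      _ ≤ (1 + c₂) ^ 3 *
          (S * (∑ m ∈ Finset.range (N + 1), lam ^ ((1 + 2 * γ) * (m + 1 : ℕ)) * v (m + 1) ^ 3) ^ 2)
          :=
          mul_le_mul_of_nonneg_left hcube (by positivity)
      _ = (1 + c₂) ^ 3 * S *
          (∑ m ∈ Finset.range (N + 1), lam ^ ((1 + 2 * γ) * (m + 1 : ℕ)) * v (m + 1) ^ 3) ^ 2 :=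
          by ring
  have hsq : ((∑ m ∈ Finset.range (N + 1), lam ^ (2 * γ * (m + 1 : ℕ)) * v (m + 1) ^ 2) + c₂ *
      (∑ m ∈ Finset.range N, lam ^ (2 * γ * (m + 1 : ℕ)) * (v (m + 1) * v (m + 2)))) ^ (3 / 2 : ℝ) =
      Real.sqrt (((∑ m ∈ Finset.range (N + 1), lam ^ (2 * γ * (m + 1 : ℕ)) * v (m + 1) ^ 2) + c₂ *
          (∑ m ∈ Finset.range N, lam ^ (2 * γ * (m + 1 : ℕ)) * (v (m + 1) * v (m + 2)))) ^ 3) := by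
    rw [Real.sqrt_eq_rpow, ← Real.rpow_natCast _ 3, ← Real.rpow_mul hH0]
    norm_num
  rw [hsq, ← Real.sqrt_sq hG0, ← Real.sqrt_mul' _ (sq_nonneg _)]
  exact Real.sqrt_le_sqrt h3

end holder

/-! ## The series of cubic and flux terms, and the Lyapunov function of a state (in `[0, ∞]`) -/

section ennreal

variable (hlam : 1 < lam)
include hlam

omit hlam in
/-- `∑ aₘ^{3/2} ≤ (∑ aₘ)^{3/2}` in `[0, ∞]`. [folklore] -/
theorem tsum_rpow_three_halves_le (a : ℕ → ℝ≥0∞) :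
    ∑' m, a m ^ (3 / 2 : ℝ) ≤ (∑' m, a m) ^ (3 / 2 : ℝ) := by
  have h32 : (3 / 2 : ℝ) = 1 + 1 / 2 := by norm_num
  have h : ∀ m, a m ^ (3 / 2 : ℝ) ≤ a m * (∑' k, a k) ^ (1 / 2 : ℝ) := fun m => by
    rw [h32, ENNReal.rpow_add_of_nonneg _ _ (by norm_num) (by norm_num), ENNReal.rpow_one]
    exact mul_le_mul_of_nonneg_left (ENNReal.rpow_le_rpow (ENNReal.le_tsum m) (by norm_num)) bot_le
  calc ∑' m, a m ^ (3 / 2 : ℝ) ≤ ∑' m, a m * (∑' k, a k) ^ (1 / 2 : ℝ) := ENNReal.tsum_le_tsum h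
    _ = (∑' m, a m) * (∑' k, a k) ^ (1 / 2 : ℝ) := ENNReal.tsum_mul_right
    _ = (∑' m, a m) ^ (3 / 2 : ℝ) := by
        rw [h32, ENNReal.rpow_add_of_nonneg _ _ (by norm_num) (by norm_num), ENNReal.rpow_one]

omit hlam in
/-- A shifted series is dominated by the full series (`[0, ∞]`-valued terms). [folklore] -/
theorem tsum_succ_le (f : ℕ → ℝ≥0∞) : ∑' m, f (m + 1) ≤ ∑' m, f m := by
  rw [tsum_eq_zero_add' (f := f) ENNReal.summable]
  exact le_add_self

/-- **The cubic series is dominated by `‖u‖³_{1/3+γ}`** (first display of the printed proof: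
`∑ λ^{(1+2γ)n}uₙ³ ≤ (∑ λ^{⅔(1+2γ)n}uₙ²)^{3/2} = ‖u‖³_{1/3+γ}`), here in `[0, ∞]`.
[cite: Cheskidov2008, §5 proof of Thm. 5.3, (5.2)] -/
theorem cubic_tsum_le (hγ : 0 ≤ γ) {v : ℕ → ℝ} (hv : ∀ n, 0 ≤ v n) :
    ∑' m, ENNReal.ofReal ((lam ^ ((1 + 2 * γ) * (m + 1 : ℕ)) * v (m + 1) ^ 3)) ≤
        dyadicNormSq lam (1 / 3 + γ) v ^ (3 / 2 : ℝ) := by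
  have hl : 0 < lam := by linarith
  rw [dyadicNormSq_eq_tsum_succ]
  have hx : ∀ m : ℕ, 0 ≤ lam ^ ((2 / 3 * (1 + 2 * γ) : ℝ) * ((m + 1 : ℕ) : ℝ)) * v (m + 1) ^ 2 :=
    fun m => mul_nonneg (Real.rpow_nonneg hl.le _) (sq_nonneg _)
  have hid : ∀ m : ℕ, ENNReal.ofReal ((lam ^ ((1 + 2 * γ) * (m + 1 : ℕ)) * v (m + 1) ^ 3)) =
      ENNReal.ofReal (lam ^ ((2 / 3 * (1 + 2 * γ) : ℝ) * ((m + 1 : ℕ) : ℝ)) * v (m + 1) ^ 2) ^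
        (3 / 2 : ℝ) := by
    intro m
    rw [ENNReal.ofReal_rpow_of_nonneg (hx m) (by norm_num)]
    congr 1
    have e1 : (lam ^ ((2 / 3 * (1 + 2 * γ) : ℝ) * ((m + 1 : ℕ) : ℝ))) ^ (3 / 2 : ℝ) =
        lam ^ ((1 + 2 * γ : ℝ) * ((m + 1 : ℕ) : ℝ)) := by
      rw [← Real.rpow_mul hl.le]
      congr 1
      ring
    have e2 : (v (m + 1) ^ 2) ^ (3 / 2 : ℝ) = v (m + 1) ^ 3 := by
      rw [← Real.rpow_natCast (v (m + 1)) 2, ← Real.rpow_mul (hv _),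
        ← Real.rpow_natCast (v (m + 1)) 3]
      congr 1
      norm_num
    rw [Real.mul_rpow (Real.rpow_nonneg hl.le _) (sq_nonneg _), e1, e2]
  have hw : ∀ m : ℕ, lam ^ ((2 / 3 * (1 + 2 * γ) : ℝ) * ((m + 1 : ℕ) : ℝ)) * v (m + 1) ^ 2 ≤
      lam ^ (2 * (1 / 3 + γ) * (m + 1 : ℕ)) * v (m + 1) ^ 2 := fun m =>
    mul_le_mul_of_nonneg_right
      (w_le_w hlam (θ := 2 / 3 * (1 + 2 * γ)) (θ' := 2 * (1 / 3 + γ)) (by linarith) (m + 1))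
      (sq_nonneg _)
  calc ∑' m, ENNReal.ofReal ((lam ^ ((1 + 2 * γ) * (m + 1 : ℕ)) * v (m + 1) ^ 3))
      = ∑' m, ENNReal.ofReal (lam ^ ((2 / 3 * (1 + 2 * γ) : ℝ) * ((m + 1 : ℕ) : ℝ)) *
          v (m + 1) ^ 2) ^ (3 / 2 : ℝ) := tsum_congr hid
    _ ≤ (∑' m, ENNReal.ofReal (lam ^ ((2 / 3 * (1 + 2 * γ) : ℝ) * ((m + 1 : ℕ) : ℝ)) *
          v (m + 1) ^ 2)) ^ (3 / 2 : ℝ) := tsum_rpow_three_halves_le _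
    _ ≤ _ := ENNReal.rpow_le_rpow (ENNReal.tsum_le_tsum fun m => ENNReal.ofReal_le_ofReal (hw m))
          (by norm_num)

/-- **The flux series is dominated by twice the cubic series** (`uₙ²uₙ₊₁ ≤ uₙ³ + u³ₙ₊₁` and
`λ^{(1+2γ)n} ≤ λ^{(1+2γ)(n+1)}`; first display of the printed proof), in `[0, ∞]`.
[cite: Cheskidov2008, §5 proof of Thm. 5.3, (5.2)] -/
theorem flux_tsum_le (hγ : 0 ≤ γ) {v : ℕ → ℝ} (hv : ∀ n, 0 ≤ v n) :
    ∑' m, ENNReal.ofReal ((lam ^ ((1 + 2 * γ) * (m + 1 : ℕ)) * (v (m + 1) ^ 2 * v (m + 2)))) ≤ 2 *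
        ∑' m, ENNReal.ofReal ((lam ^ ((1 + 2 * γ) * (m + 1 : ℕ)) * v (m + 1) ^ 3)) := by
  have hl : 0 < lam := by linarith
  have hterm : ∀ m : ℕ,
      ENNReal.ofReal ((lam ^ ((1 + 2 * γ) * (m + 1 : ℕ)) * (v (m + 1) ^ 2 * v (m + 2)))) ≤
      ENNReal.ofReal ((lam ^ ((1 + 2 * γ) * (m + 1 : ℕ)) * v (m + 1) ^ 3)) +
      ENNReal.ofReal (lam ^ ((1 + 2 * γ : ℝ) * ((m + 2 : ℕ) : ℝ)) * v (m + 2) ^ 3) := by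
    intro m
    rw [← ENNReal.ofReal_add (mul_nonneg (Real.rpow_nonneg hl.le _) (pow_nonneg (hv _) 3))
      (mul_nonneg (Real.rpow_nonneg hl.le _) (pow_nonneg (hv _) 3))]
    refine ENNReal.ofReal_le_ofReal ?_
    have hw : 0 ≤ lam ^ ((1 + 2 * γ : ℝ) * ((m + 1 : ℕ) : ℝ)) := Real.rpow_nonneg hl.le _
    have h1 := mul_le_mul_of_nonneg_left (sq_mul_le_cube_add_cube (hv (m + 1)) (hv (m + 2))) hw
    have h2 := mul_le_mul_of_nonneg_right (w_mono_succ hlam (θ := 1 + 2 * γ) (by positivity) m)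
      (pow_nonneg (hv (m + 2)) 3)
    linarith
  have h1 : ∑' m,
      ENNReal.ofReal ((lam ^ ((1 + 2 * γ) * (m + 1 : ℕ)) * (v (m + 1) ^ 2 * v (m + 2)))) ≤
      ∑' m, (ENNReal.ofReal ((lam ^ ((1 + 2 * γ) * (m + 1 : ℕ)) * v (m + 1) ^ 3)) +
        ENNReal.ofReal (lam ^ ((1 + 2 * γ : ℝ) * ((m + 2 : ℕ) : ℝ)) * v (m + 2) ^ 3)) :=
    ENNReal.tsum_le_tsum hterm
  have h2 : ∑' m, (ENNReal.ofReal ((lam ^ ((1 + 2 * γ) * (m + 1 : ℕ)) * v (m + 1) ^ 3)) +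
        ENNReal.ofReal (lam ^ ((1 + 2 * γ : ℝ) * ((m + 2 : ℕ) : ℝ)) * v (m + 2) ^ 3)) =
      ∑' m, ENNReal.ofReal ((lam ^ ((1 + 2 * γ) * (m + 1 : ℕ)) * v (m + 1) ^ 3)) +
        ∑' m, ENNReal.ofReal (lam ^ ((1 + 2 * γ : ℝ) * ((m + 2 : ℕ) : ℝ)) * v (m + 2) ^ 3) :=
    ENNReal.tsum_add
  have h3 : ∑' m, ENNReal.ofReal (lam ^ ((1 + 2 * γ : ℝ) * ((m + 2 : ℕ) : ℝ)) * v (m + 2) ^ 3) ≤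
      ∑' m, ENNReal.ofReal ((lam ^ ((1 + 2 * γ) * (m + 1 : ℕ)) * v (m + 1) ^ 3)) :=
    tsum_succ_le (fun n => ENNReal.ofReal ((lam ^ ((1 + 2 * γ) * (n + 1 : ℕ)) * v (n + 1) ^ 3)))
  have h4 := h1.trans (h2.le.trans (add_le_add le_rfl h3))
  rwa [← two_mul] at h4

/-- The truncated Lyapunov functions `H_N = ∑_{n≤N+1}λ^{2γn}uₙ² + c₂∑_{n≤N}λ^{2γn}uₙuₙ₊₁`
increase with `N` at a non-negative state. [cite: Cheskidov2008, §5 proof of Thm. 5.3] -/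
theorem lyapunov_mono {c₂ : ℝ} (hc₂ : 0 ≤ c₂) {v : ℕ → ℝ} (hv : ∀ n, 0 ≤ v n) :
    Monotone fun N =>
        ENNReal.ofReal
        ((∑ m ∈ Finset.range (N + 1), lam ^ (2 * γ * (m + 1 : ℕ)) * v (m + 1) ^ 2) + c₂ *
        (∑ m ∈ Finset.range N, lam ^ (2 * γ * (m + 1 : ℕ)) * (v (m + 1) * v (m + 2)))) := by
  have hl : 0 < lam := by linarith
  refine monotone_nat_of_le_succ fun N => ENNReal.ofReal_le_ofReal ?_
  have e1 : (∑ m ∈ Finset.range (N + 1 + 1), lam ^ (2 * γ * (m + 1 : ℕ)) * v (m + 1) ^ 2) =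
      (∑ m ∈ Finset.range (N + 1), lam ^ (2 * γ * (m + 1 : ℕ)) * v (m + 1) ^ 2) +
      (lam ^ (2 * γ * ((N + 1) + 1 : ℕ)) * v ((N + 1) + 1) ^ 2) := Finset.sum_range_succ _ _
  have e2 : (∑ m ∈ Finset.range (N + 1), lam ^ (2 * γ * (m + 1 : ℕ)) * (v (m + 1) * v (m + 2))) =
      (∑ m ∈ Finset.range N, lam ^ (2 * γ * (m + 1 : ℕ)) * (v (m + 1) * v (m + 2))) +
      (lam ^ (2 * γ * (N + 1 : ℕ)) * (v (N + 1) * v (N + 2))) := Finset.sum_range_succ _ _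
  rw [e1, e2]
  have h1 : 0 ≤ (lam ^ (2 * γ * ((N + 1) + 1 : ℕ)) * v ((N + 1) + 1) ^ 2) :=
      mul_nonneg (Real.rpow_nonneg hl.le _) (sq_nonneg _)
  have h2 : 0 ≤ c₂ * (lam ^ (2 * γ * (N + 1 : ℕ)) * (v (N + 1) * v (N + 2))) :=
    mul_nonneg hc₂ (mul_nonneg (Real.rpow_nonneg hl.le _) (mul_nonneg (hv _) (hv _)))
  linarith

/-- **`‖u‖²_γ ≤ H`**: the `γ`-energy of a non-negative state is at most its Lyapunov function
`H = sup_N H_N`. [cite: Cheskidov2008, §5 proof of Thm. 5.3] -/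
theorem dyadicNormSq_le_lyapunov {c₂ : ℝ} (hc₂ : 0 ≤ c₂) {v : ℕ → ℝ} (hv : ∀ n, 0 ≤ v n) :
    dyadicNormSq lam γ v ≤ ⨆ N : ℕ,
        ENNReal.ofReal
        ((∑ m ∈ Finset.range (N + 1), lam ^ (2 * γ * (m + 1 : ℕ)) * v (m + 1) ^ 2) + c₂ *
        (∑ m ∈ Finset.range N, lam ^ (2 * γ * (m + 1 : ℕ)) * (v (m + 1) * v (m + 2)))) := by
  have hl : 0 < lam := by linarith
  rw [dyadicNormSq_eq_tsum_succ, ENNReal.tsum_eq_iSup_nat]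
  refine iSup_le fun N => le_iSup_of_le N ?_
  have hwE : ∀ m, 0 ≤ (lam ^ (2 * γ * (m + 1 : ℕ)) * v (m + 1) ^ 2) := fun m =>
      mul_nonneg (Real.rpow_nonneg hl.le _) (sq_nonneg _)
  have hP0 : 0 ≤ (∑ m ∈ Finset.range N, lam ^ (2 * γ * (m + 1 : ℕ)) * (v (m + 1) * v (m + 2))) :=
    Finset.sum_nonneg fun m _ => mul_nonneg (Real.rpow_nonneg hl.le _) (mul_nonneg (hv _) (hv _))
  rw [← ENNReal.ofReal_sum_of_nonneg fun m _ => hwE m]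
  refine ENNReal.ofReal_le_ofReal ?_
  have := sum_range_le_sum_range_add hwE N 1
  nlinarith

/-- **`H ≤ (1+c₂)‖u‖²_{1/3+γ}`**: the Lyapunov function of a non-negative state is dominated by
the `H^{1/3+γ}`-norm (`H ≤ (1+c₂)‖u‖²_γ ≤ (1+c₂)‖u‖²_{1/3+γ}`).
[cite: Cheskidov2008, §5 proof of Thm. 5.3] -/
theorem lyapunov_le_dyadicNormSq (hγ : 0 ≤ γ) {c₂ : ℝ} (hc₂ : 0 ≤ c₂) (v : ℕ → ℝ) :
    ⨆ N : ℕ, ENNReal.ofReal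
        ((∑ m ∈ Finset.range (N + 1), lam ^ (2 * γ * (m + 1 : ℕ)) * v (m + 1) ^ 2) + c₂ *
        (∑ m ∈ Finset.range N, lam ^ (2 * γ * (m + 1 : ℕ)) * (v (m + 1) * v (m + 2)))) ≤
      ENNReal.ofReal (1 + c₂) * dyadicNormSq lam (1 / 3 + γ) v := by
  have hl : 0 < lam := by linarith
  rw [dyadicNormSq_eq_tsum_succ]
  refine iSup_le fun N => ?_
  have hPS := coupling_sum_le (γ := γ) hlam hγ v N
  have hw3 : ∀ m, 0 ≤ lam ^ (2 * (1 / 3 + γ) * (m + 1 : ℕ)) * v (m + 1) ^ 2 := fun m =>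
    mul_nonneg (Real.rpow_nonneg hl.le _) (sq_nonneg _)
  have hEle : (∑ m ∈ Finset.range (N + 1), lam ^ (2 * γ * (m + 1 : ℕ)) * v (m + 1) ^ 2) ≤
      ∑ m ∈ Finset.range (N + 1), lam ^ (2 * (1 / 3 + γ) * (m + 1 : ℕ)) * v (m + 1) ^ 2 :=
    Finset.sum_le_sum fun m _ => mul_le_mul_of_nonneg_right
      (w_le_w hlam (θ := 2 * γ) (θ' := 2 * (1 / 3 + γ)) (by linarith) (m + 1)) (sq_nonneg _)
  calc ENNReal.ofReal
          ((∑ m ∈ Finset.range (N + 1), lam ^ (2 * γ * (m + 1 : ℕ)) * v (m + 1) ^ 2) + c₂ *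
          (∑ m ∈ Finset.range N, lam ^ (2 * γ * (m + 1 : ℕ)) * (v (m + 1) * v (m + 2))))
      ≤ ENNReal.ofReal ((1 + c₂) *
          ∑ m ∈ Finset.range (N + 1), lam ^ (2 * (1 / 3 + γ) * (m + 1 : ℕ)) * v (m + 1) ^ 2) :=
        ENNReal.ofReal_le_ofReal (by nlinarith)
    _ = ENNReal.ofReal (1 + c₂) *
          ∑ m ∈ Finset.range (N + 1), ENNReal.ofReal (lam ^ (2 * (1 / 3 + γ) * (m + 1 : ℕ)) *
            v (m + 1) ^ 2) := by
        rw [ENNReal.ofReal_mul (by linarith), ENNReal.ofReal_sum_of_nonneg fun m _ => hw3 m]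
    _ ≤ _ := mul_le_mul_of_nonneg_left (ENNReal.sum_le_tsum _) bot_le

/-- **`H^{3/2} ≲ ∑ λ^{(1+2γ)n}uₙ³` in `[0, ∞]`**: the limit form of `lyapunov_rpow_le`.
[cite: Cheskidov2008, §5 proof of Thm. 5.3, (5.7) and Lemma 5.1] -/
theorem lyapunov_rpow_le_tsum (hγ : 0 ≤ γ) (hγ1 : γ < 1) {c₂ : ℝ} (hc₂ : 0 ≤ c₂) {v : ℕ → ℝ}
    (hv : ∀ n, 0 ≤ v n) :
    (⨆ N : ℕ, ENNReal.ofReal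
        ((∑ m ∈ Finset.range (N + 1), lam ^ (2 * γ * (m + 1 : ℕ)) * v (m + 1) ^ 2) + c₂ *
        (∑ m ∈ Finset.range N, lam ^ (2 * γ * (m + 1 : ℕ)) * (v (m + 1) * v (m + 2))))) ^
        (3 / 2 : ℝ) ≤
      ENNReal.ofReal (Real.sqrt ((1 + c₂) ^ 3 *
          (lam ^ (-(2 * (1 - γ))) / (1 - lam ^ (-(2 * (1 - γ))))))) *
        ∑' m, ENNReal.ofReal ((lam ^ ((1 + 2 * γ) * (m + 1 : ℕ)) * v (m + 1) ^ 3)) := by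
  have hl : 0 < lam := by linarith
  have hmono := lyapunov_mono (γ := γ) hlam hc₂ hv
  have hT : Tendsto
      (fun N => ENNReal.ofReal
      ((∑ m ∈ Finset.range (N + 1), lam ^ (2 * γ * (m + 1 : ℕ)) * v (m + 1) ^ 2) + c₂ *
      (∑ m ∈ Finset.range N, lam ^ (2 * γ * (m + 1 : ℕ)) * (v (m + 1) * v (m + 2)))) ^ (3 / 2 : ℝ))
      atTop (𝓝 ((⨆ N : ℕ,
          ENNReal.ofReal
          ((∑ m ∈ Finset.range (N + 1), lam ^ (2 * γ * (m + 1 : ℕ)) * v (m + 1) ^ 2) + c₂ *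
          (∑ m ∈ Finset.range N, lam ^ (2 * γ * (m + 1 : ℕ)) * (v (m + 1) * v (m + 2))))) ^
          (3 / 2 : ℝ))) :=
    (ENNReal.continuous_rpow_const.tendsto _).comp (tendsto_atTop_iSup hmono)
  refine le_of_tendsto' hT fun N => ?_
  have hgT : ∀ m, 0 ≤ (lam ^ ((1 + 2 * γ) * (m + 1 : ℕ)) * v (m + 1) ^ 3) := fun m =>
      mul_nonneg (Real.rpow_nonneg hl.le _) (pow_nonneg (hv _) 3)
  have hE0 : 0 ≤ (∑ m ∈ Finset.range (N + 1), lam ^ (2 * γ * (m + 1 : ℕ)) * v (m + 1) ^ 2) :=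
    Finset.sum_nonneg fun m _ => mul_nonneg (Real.rpow_nonneg hl.le _) (sq_nonneg _)
  have hP0 : 0 ≤ (∑ m ∈ Finset.range N, lam ^ (2 * γ * (m + 1 : ℕ)) * (v (m + 1) * v (m + 2))) :=
    Finset.sum_nonneg fun m _ => mul_nonneg (Real.rpow_nonneg hl.le _) (mul_nonneg (hv _) (hv _))
  have hH0 : 0 ≤ (∑ m ∈ Finset.range (N + 1), lam ^ (2 * γ * (m + 1 : ℕ)) * v (m + 1) ^ 2) + c₂ *
      (∑ m ∈ Finset.range N, lam ^ (2 * γ * (m + 1 : ℕ)) * (v (m + 1) * v (m + 2))) := by positivity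
  rw [ENNReal.ofReal_rpow_of_nonneg hH0 (by norm_num)]
  calc ENNReal.ofReal
          (((∑ m ∈ Finset.range (N + 1), lam ^ (2 * γ * (m + 1 : ℕ)) * v (m + 1) ^ 2) + c₂ *
          (∑ m ∈ Finset.range N, lam ^ (2 * γ * (m + 1 : ℕ)) * (v (m + 1) * v (m + 2)))) ^
          (3 / 2 : ℝ))
      ≤ ENNReal.ofReal (Real.sqrt ((1 + c₂) ^ 3 *
          (lam ^ (-(2 * (1 - γ))) / (1 - lam ^ (-(2 * (1 - γ)))))) *
              (∑ m ∈ Finset.range (N + 1), lam ^ ((1 + 2 * γ) * (m + 1 : ℕ)) * v (m + 1) ^ 3)) :=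
        ENNReal.ofReal_le_ofReal (lyapunov_rpow_le (γ := γ) hlam hγ hγ1 hc₂ hv N)
    _ = ENNReal.ofReal (Real.sqrt ((1 + c₂) ^ 3 *
          (lam ^ (-(2 * (1 - γ))) / (1 - lam ^ (-(2 * (1 - γ))))))) *
          ∑ m ∈ Finset.range (N + 1),
              ENNReal.ofReal ((lam ^ ((1 + 2 * γ) * (m + 1 : ℕ)) * v (m + 1) ^ 3)) := by
        rw [ENNReal.ofReal_mul (Real.sqrt_nonneg _), ENNReal.ofReal_sum_of_nonneg fun m _ => hgT m]
    _ ≤ _ := mul_le_mul_of_nonneg_left (ENNReal.sum_le_tsum _) bot_le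

end ennreal

/-! ## Positivity of solutions (Theorem 4.2, first part) -/

section positivity

/-- **A scalar linear ODE with non-negative source preserves non-negativity**: if
`f' = -a f + b` on `[0, T)` (right derivatives), `a` continuous, `b ≥ 0` and `f(0) ≥ 0`, then
`f ≥ 0` on `[0, T]` (the integrating-factor formula of the printed proof of Thm. 4.2, here via a
comparison/fencing argument with the barriers `ε e^{(K+1)t}`, `K = sup|a|`).
[cite: Cheskidov2008, §4 Thm. 4.2 (proof)] -/
theorem nonneg_of_deriv_linear {f a b : ℝ → ℝ} {T : ℝ} (hT : 0 ≤ T)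
    (hf : ContinuousOn f (Icc 0 T)) (ha : ContinuousOn a (Icc 0 T))
    (hder : ∀ t ∈ Ico 0 T, HasDerivWithinAt f (-a t * f t + b t) (Ici t) t)
    (hb : ∀ t ∈ Ico 0 T, 0 ≤ b t) (h0 : 0 ≤ f 0) : ∀ t ∈ Icc 0 T, 0 ≤ f t := by
  obtain ⟨K, hK⟩ := isCompact_Icc.exists_bound_of_continuousOn ha
  have hK0 : 0 ≤ K := le_trans (norm_nonneg _) (hK 0 (left_mem_Icc.2 hT))
  have key : ∀ ε : ℝ, 0 < ε → ∀ s ∈ Icc 0 T, -f s ≤ ε * Real.exp ((K + 1) * s) := by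
    intro ε hε s hs
    have hB : ∀ x, HasDerivAt (fun y => ε * Real.exp ((K + 1) * y))
        (ε * (Real.exp ((K + 1) * x) * ((K + 1) * 1))) x := fun x =>
      ((Real.hasDerivAt_exp _).comp x ((hasDerivAt_id x).const_mul (K + 1))).const_mul ε
    refine image_le_of_deriv_right_lt_deriv_boundary' (f := fun y => -f y)
      (f' := fun y => -(-a y * f y + b y)) (a := 0) (b := T) hf.neg
      (fun x hx => (hder x hx).neg) ?_ (fun x _ => (hB x).continuousAt.continuousWithinAt)
      (fun x _ => (hB x).hasDerivWithinAt) ?_ hs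
    · simp only [mul_zero, Real.exp_zero, mul_one]
      linarith
    · intro x hx hfx
      have hax : |a x| ≤ K := by simpa [Real.norm_eq_abs] using hK x (Ico_subset_Icc_self hx)
      have hpos : 0 < ε * Real.exp ((K + 1) * x) := mul_pos hε (Real.exp_pos _)
      have hbx := hb x hx
      have h1 : -a x * (ε * Real.exp ((K + 1) * x)) ≤ K * (ε * Real.exp ((K + 1) * x)) := by
        have : -a x ≤ K := le_trans (neg_le_abs (a x)) hax
        exact mul_le_mul_of_nonneg_right this hpos.le
      have hfx' : f x = -(ε * Real.exp ((K + 1) * x)) := by linarith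
      rw [hfx']
      nlinarith
  intro t ht
  by_contra hneg
  have hneg' : f t < 0 := lt_of_not_ge hneg
  have hE : 0 < Real.exp ((K + 1) * t) := Real.exp_pos _
  have := key ((-f t) / (2 * Real.exp ((K + 1) * t))) (div_pos (by linarith) (by positivity)) t ht
  have h2 : (-f t) / (2 * Real.exp ((K + 1) * t)) * Real.exp ((K + 1) * t) = (-f t) / 2 := by
    field_simp
  rw [h2] at this
  linarith

/-- **Theorem 4.2 (positivity)**: "Let `u(t)` be a solution of (3.1) with `uₙ(0) ≥ 0`. Then
`uₙ(t) ≥ 0` for all `t > 0`" (for `λ ≥ 0` and non-negative force `gₙ ≥ 0`; each `uₙ` solves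
`uₙ' = -(νλ^{2αn} + λ^{n+1}uₙ₊₁)uₙ + (λⁿu²ₙ₋₁ + gₙ)`). [cite: Cheskidov2008, §4 Thm. 4.2] -/
theorem nonneg_of_isCheskidovSolution (hlam : 0 ≤ lam) (hg : ∀ n, 1 ≤ n → 0 ≤ g n)
    {u0 : ℕ → ℝ} (hu0 : ∀ n, 1 ≤ n → 0 ≤ u0 n) {u : ℕ → ℝ → ℝ}
    (hu : IsCheskidovSolution lam ν α g u0 u) : ∀ n t, 0 ≤ t → 0 ≤ u n t := by
  obtain ⟨h0, hinit, hder, -⟩ := hu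
  have hcont : ∀ n, ContinuousOn (u n) (Ici 0) := by
    intro n
    rcases Nat.eq_zero_or_pos n with rfl | hn
    · exact (continuousOn_const (c := (0 : ℝ))).congr fun t _ => h0 t
    · exact fun t ht => (hder n hn t ht).continuousWithinAt
  intro n t ht
  rcases Nat.eq_zero_or_pos n with rfl | hn
  · rw [h0 t]
  obtain ⟨m, rfl⟩ : ∃ m, n = m + 1 := ⟨n - 1, by omega⟩
  refine nonneg_of_deriv_linear (f := u (m + 1))
    (a := fun s => ν * lam ^ (2 * α * (m + 1 : ℕ)) + lam ^ (m + 2) * u (m + 2) s)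
    (b := fun s => lam ^ (m + 1) * u m s ^ 2 + g (m + 1)) ht
    ((hcont _).mono Icc_subset_Ici_self) ?_ ?_ ?_ ?_ t ⟨ht, le_rfl⟩
  · exact (continuousOn_const.add (continuousOn_const.mul
      ((hcont _).mono Icc_subset_Ici_self)))
  · intro s hs
    refine ((hder (m + 1) le_add_self s hs.1).mono (Ici_subset_Ici.2 hs.1)).congr_deriv ?_
    rw [cheskidovRHS_succ]
    ring
  · intro s _
    exact add_nonneg (mul_nonneg (pow_nonneg hlam _) (sq_nonneg _)) (hg _ le_add_self)
  · rw [hinit _ le_add_self]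
    exact hu0 _ le_add_self

end positivity

/-! ## Extension of a solution to a continuous function on `ℝ` -/

section extension

/-- **Solutions restricted to `t ≥ 0` and extended constantly to `t < 0`** are again solutions
(the solution predicate only sees `t ≥ 0`), with every mode continuous on `ℝ`; the extension
is written with time as the first argument, `U τ n = uₙ(max(τ,0))`.
[cite: Cheskidov2008, §3 Def. 3.1] -/
theorem extend_isCheskidovSolution {u0 : ℕ → ℝ} {u : ℕ → ℝ → ℝ}
    (hu : IsCheskidovSolution lam ν α g u0 u) :
    (∀ τ, u 0 (max τ 0) = 0) ∧
    (∀ m τ, 0 ≤ τ → HasDerivWithinAt (fun s => u (m + 1) (max s 0))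
        (cheskidovRHS lam ν α g (fun k => u k (max τ 0)) (m + 1)) (Ici 0) τ) ∧
    (∀ k, Continuous fun s => u k (max s 0)) := by
  obtain ⟨h0, -, hder, -⟩ := hu
  refine ⟨fun τ => h0 _, fun m τ hτ => ?_, fun k => ?_⟩
  · rw [max_eq_left hτ]
    exact (hder (m + 1) le_add_self τ hτ).congr
        (fun s hs => by rw [max_eq_left (show 0 ≤ s from hs)])
      (by rw [max_eq_left hτ])
  · have hcont : ContinuousOn (u k) (Ici 0) := by
      rcases Nat.eq_zero_or_pos k with rfl | hk
      · exact (continuousOn_const (c := (0 : ℝ))).congr fun t _ => h0 t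
      · exact fun t ht => (hder k hk t ht).continuousWithinAt
    exact hcont.comp_continuous (continuous_id.max continuous_const) fun s =>
      Set.mem_Ici.2 (le_max_right _ _)

end extension

/-! ## The Lyapunov inequality along a solution

Below `U : ℝ → ℕ → ℝ` is a solution written with time first (`U τ` is the state at time `τ`),
with `U τ 0 = 0`, every mode continuous on `ℝ` and non-negative, and satisfying (3.1) on
`[0, ∞)` (cf. `extend_isCheskidovSolution`, `nonneg_of_isCheskidovSolution`). -/


section solution

variable {U : ℝ → ℕ → ℝ}

/-- **The truncated Lyapunov function is differentiable along a solution**, with derivative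
`h_N = e_{N+1} + c₂p_N` (product rule, mode by mode). [cite: Cheskidov2008, §5 proof of Thm. 5.3] -/
theorem hasDerivWithinAt_lyapunov
    (hder : ∀ m τ, 0 ≤ τ → HasDerivWithinAt (fun s => U s (m + 1))
      (cheskidovRHS lam ν α g (U τ) (m + 1)) (Ici 0) τ)
    (c₂ : ℝ) (N : ℕ) {τ : ℝ} (hτ : 0 ≤ τ) :
    HasDerivWithinAt
        (fun s => (∑ m ∈ Finset.range (N + 1), lam ^ (2 * γ * (m + 1 : ℕ)) * (U s) (m + 1) ^ 2) +
        c₂ * (∑ m ∈ Finset.range N, lam ^ (2 * γ * (m + 1 : ℕ)) * ((U s) (m + 1) * (U s) (m + 2))))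
      ((∑ m ∈ Finset.range (N + 1), lam ^ (2 * γ * (m + 1 : ℕ)) *
          (2 * (U τ) (m + 1) * cheskidovRHS lam ν α g (U τ) (m + 1))) + c₂ *
          (∑ m ∈ Finset.range N, lam ^ (2 * γ * (m + 1 : ℕ)) *
          (cheskidovRHS lam ν α g (U τ) (m + 1) * (U τ) (m + 2) + (U τ) (m + 1) *
          cheskidovRHS lam ν α g (U τ) (m + 2)))) (Ici 0) τ := by
  refine HasDerivWithinAt.add (HasDerivWithinAt.fun_sum fun m _ => ?_)
    ((HasDerivWithinAt.fun_sum fun m _ => ?_).const_mul c₂)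
  · exact (hasDerivWithinAt_sq (hder m τ hτ)).const_mul _
  · have h2 : HasDerivWithinAt (fun s => U s (m + 2)) (cheskidovRHS lam ν α g (U τ) (m + 2))
        (Ici 0) τ := hder (m + 1) τ hτ
    exact ((hder m τ hτ).mul h2).const_mul _

/-- The truncated Lyapunov function is continuous along continuous modes. [folklore] -/
theorem continuous_lyapunov (hcont : ∀ k, Continuous fun s => U s k) (c₂ : ℝ) (N : ℕ) :
    Continuous fun s =>
        (∑ m ∈ Finset.range (N + 1), lam ^ (2 * γ * (m + 1 : ℕ)) * (U s) (m + 1) ^ 2) + c₂ *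
        (∑ m ∈ Finset.range N, lam ^ (2 * γ * (m + 1 : ℕ)) * ((U s) (m + 1) * (U s) (m + 2))) :=
  (continuous_finsetSum _ fun _ _ => continuous_const.mul ((hcont _).pow 2)).add
    (continuous_const.mul (continuous_finsetSum _ fun _ _ =>
      continuous_const.mul ((hcont _).mul (hcont _))))

/-- The derivative `h_N` is continuous along continuous modes. [folklore] -/
theorem continuous_lyapunov_deriv (hcont : ∀ k, Continuous fun s => U s k) (c₂ : ℝ) (N : ℕ) :
    Continuous fun s =>
        (∑ m ∈ Finset.range (N + 1), lam ^ (2 * γ * (m + 1 : ℕ)) *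
        (2 * (U s) (m + 1) * cheskidovRHS lam ν α g (U s) (m + 1))) + c₂ *
        (∑ m ∈ Finset.range N, lam ^ (2 * γ * (m + 1 : ℕ)) *
        (cheskidovRHS lam ν α g (U s) (m + 1) * (U s) (m + 2) + (U s) (m + 1) *
        cheskidovRHS lam ν α g (U s) (m + 2))) := by
  have hR : ∀ m, Continuous fun s => cheskidovRHS lam ν α g (U s) (m + 1) := fun m =>
    continuous_cheskidovRHS_succ (U := fun k s => U s k) hcont m
  have hR2 : ∀ m, Continuous fun s => cheskidovRHS lam ν α g (U s) (m + 2) := fun m => hR (m + 1)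
  exact (continuous_finsetSum _ fun m _ =>
      continuous_const.mul ((continuous_const.mul (hcont _)).mul (hR m))).add
    (continuous_const.mul (continuous_finsetSum _ fun m _ =>
      continuous_const.mul (((hR m).mul (hcont _)).add ((hcont _).mul (hR2 m)))))

/-- The cubic terms are continuous along continuous modes. [folklore] -/
theorem continuous_gT (hcont : ∀ k, Continuous fun s => U s k) (n : ℕ) :
    Continuous fun s => lam ^ ((1 + 2 * γ : ℝ) * ((n : ℕ) : ℝ)) * U s n ^ 3 :=
  continuous_const.mul ((hcont _).pow 3)

/-- The flux terms are continuous along continuous modes. [folklore] -/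
theorem continuous_fT (hcont : ∀ k, Continuous fun s => U s k) (n : ℕ) :
    Continuous fun s => lam ^ ((1 + 2 * γ : ℝ) * ((n : ℕ) : ℝ)) * (U s n ^ 2 * U s (n + 1)) :=
  continuous_const.mul (((hcont _).pow 2).mul (hcont _))

/-- The interval integral of a continuous non-negative function is the lower Lebesgue integral
over the closed interval. [folklore] -/
theorem ofReal_intervalIntegral_eq {f : ℝ → ℝ} (hf : Continuous f) (hnn : ∀ x, 0 ≤ f x)
    {s t : ℝ} (hst : s ≤ t) :
    ENNReal.ofReal (∫ x in s..t, f x) = ∫⁻ x in Icc s t, ENNReal.ofReal (f x) := by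
  rw [intervalIntegral.integral_of_le hst, ← integral_Icc_eq_integral_Ioc,
    ofReal_integral_eq_lintegral_ofReal hf.integrableOn_Icc (ae_of_all _ fun x => hnn x)]

/-- **The integrated truncated Lyapunov inequality** on `[s, t] ⊆ [0, ∞)` (fundamental theorem of
calculus for `H_N` plus `lyapunov_deriv_lower` integrated), in `[0, ∞]`-valued form:
`H_N(s) + q ∑_{n≤N}∫ₛᵗλ^{(1+2γ)n}uₙ³ ≤ H_N(t) + K(t-s) + ∫ₛᵗ R_N`.
[cite: Cheskidov2008, §5 proof of Thm. 5.3, (5.5)–(5.8)] -/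
theorem lyapunovN_integral_ineq (hlam : 1 < lam) {c₂ q K : ℝ} (hc₂ : 0 ≤ c₂) (hq : 0 ≤ q)
    (hK : 0 ≤ K)
    (hKineq : ∀ v : ℕ → ℝ, v 0 = 0 → (∀ n, 0 ≤ v n) → ∀ N : ℕ,
      q * (∑ m ∈ Finset.range N, lam ^ ((1 + 2 * γ) * (m + 1 : ℕ)) * v (m + 1) ^ 3) - K -
          ((q + 3 * c₂ / 4) * (lam ^ ((1 + 2 * γ) * (N + 1 : ℕ)) * v (N + 1) ^ 3) + c₂ / 4 *
          (lam ^ ((1 + 2 * γ) * (N + 2 : ℕ)) * v (N + 2) ^ 3) + 2 * lam ^ (1 + 2 * γ) *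
          (lam ^ ((1 + 2 * γ) * (N + 1 : ℕ)) * (v (N + 1) ^ 2 * v (N + 2)))) ≤
          (∑ m ∈ Finset.range (N + 1), lam ^ (2 * γ * (m + 1 : ℕ)) *
          (2 * v (m + 1) * cheskidovRHS lam ν α g v (m + 1))) + c₂ *
          (∑ m ∈ Finset.range N, lam ^ (2 * γ * (m + 1 : ℕ)) *
          (cheskidovRHS lam ν α g v (m + 1) * v (m + 2) + v (m + 1) *
          cheskidovRHS lam ν α g v (m + 2))))
    (hU0 : ∀ τ, U τ 0 = 0)
    (hder : ∀ m τ, 0 ≤ τ → HasDerivWithinAt (fun s => U s (m + 1))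
      (cheskidovRHS lam ν α g (U τ) (m + 1)) (Ici 0) τ)
    (hcont : ∀ k, Continuous fun s => U s k) (hnn : ∀ τ k, 0 ≤ U τ k)
    {s t : ℝ} (hs : 0 ≤ s) (hst : s ≤ t) (N : ℕ) :
    ENNReal.ofReal
        ((∑ m ∈ Finset.range (N + 1), lam ^ (2 * γ * (m + 1 : ℕ)) * (U s) (m + 1) ^ 2) + c₂ *
        (∑ m ∈ Finset.range N, lam ^ (2 * γ * (m + 1 : ℕ)) * ((U s) (m + 1) * (U s) (m + 2)))) +
        ENNReal.ofReal q * ∑ m ∈ Finset.range N, ∫⁻ τ in Icc s t,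
            ENNReal.ofReal ((lam ^ ((1 + 2 * γ) * (m + 1 : ℕ)) * (U τ) (m + 1) ^ 3)) ≤
      ENNReal.ofReal
          ((∑ m ∈ Finset.range (N + 1), lam ^ (2 * γ * (m + 1 : ℕ)) * (U t) (m + 1) ^ 2) + c₂ *
          (∑ m ∈ Finset.range N, lam ^ (2 * γ * (m + 1 : ℕ)) * ((U t) (m + 1) * (U t) (m + 2)))) +
          ENNReal.ofReal (K * (t - s)) +
        (ENNReal.ofReal (q + 3 * c₂ / 4) *
            (∫⁻ τ in Icc s t,
            ENNReal.ofReal ((lam ^ ((1 + 2 * γ) * (N + 1 : ℕ)) * (U τ) (N + 1) ^ 3))) +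
          ENNReal.ofReal (c₂ / 4) *
            (∫⁻ τ in Icc s t, ENNReal.ofReal (lam ^ ((1 + 2 * γ : ℝ) * ((N + 2 : ℕ) : ℝ)) *
              U τ (N + 2) ^ 3)) +
          ENNReal.ofReal (2 * lam ^ (1 + 2 * γ)) *
            (∫⁻ τ in Icc s t,
                ENNReal.ofReal
                ((lam ^ ((1 + 2 * γ) * (N + 1 : ℕ)) * ((U τ) (N + 1) ^ 2 * (U τ) (N + 2)))))) := by
  have hl : 0 < lam := by linarith
  -- non-negativity of the terms involved
  have hgT : ∀ τ (n : ℕ), 0 ≤ lam ^ ((1 + 2 * γ : ℝ) * ((n : ℕ) : ℝ)) * U τ n ^ 3 := fun τ n =>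
    mul_nonneg (Real.rpow_nonneg hl.le _) (pow_nonneg (hnn _ _) 3)
  have hfT : ∀ τ (n : ℕ), 0 ≤ lam ^ ((1 + 2 * γ : ℝ) * ((n : ℕ) : ℝ)) * (U τ n ^ 2 * U τ (n + 1)) :=
    fun τ n => mul_nonneg (Real.rpow_nonneg hl.le _) (mul_nonneg (sq_nonneg _) (hnn _ _))
  have hHN : ∀ τ, 0 ≤
      (∑ m ∈ Finset.range (N + 1), lam ^ (2 * γ * (m + 1 : ℕ)) * (U τ) (m + 1) ^ 2) + c₂ *
      (∑ m ∈ Finset.range N, lam ^ (2 * γ * (m + 1 : ℕ)) * ((U τ) (m + 1) * (U τ) (m + 2))) :=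
      fun τ =>
    add_nonneg (Finset.sum_nonneg fun m _ => mul_nonneg (Real.rpow_nonneg hl.le _) (sq_nonneg _))
      (mul_nonneg hc₂ (Finset.sum_nonneg fun m _ =>
        mul_nonneg (Real.rpow_nonneg hl.le _) (mul_nonneg (hnn _ _) (hnn _ _))))
  have hL : 0 ≤ 2 * lam ^ (1 + 2 * γ) := mul_nonneg (by norm_num) (Real.rpow_nonneg hl.le _)
  -- continuity / integrability
  have cG : Continuous fun τ =>
      (∑ m ∈ Finset.range N, lam ^ ((1 + 2 * γ) * (m + 1 : ℕ)) * (U τ) (m + 1) ^ 3) :=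
    continuous_finsetSum _ fun m _ => continuous_gT hcont (m + 1)
  have cR : Continuous fun τ =>
      ((q + 3 * c₂ / 4) * (lam ^ ((1 + 2 * γ) * (N + 1 : ℕ)) * (U τ) (N + 1) ^ 3) + c₂ / 4 *
      (lam ^ ((1 + 2 * γ) * (N + 2 : ℕ)) * (U τ) (N + 2) ^ 3) + 2 * lam ^ (1 + 2 * γ) *
      (lam ^ ((1 + 2 * γ) * (N + 1 : ℕ)) * ((U τ) (N + 1) ^ 2 * (U τ) (N + 2)))) :=
    ((continuous_const.mul (continuous_gT hcont (N + 1))).add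
      (continuous_const.mul (continuous_gT hcont (N + 2)))).add
      (continuous_const.mul (continuous_fT hcont (N + 1)))
  have cψ : Continuous fun τ => q *
      (∑ m ∈ Finset.range N, lam ^ ((1 + 2 * γ) * (m + 1 : ℕ)) * (U τ) (m + 1) ^ 3) - K -
      ((q + 3 * c₂ / 4) * (lam ^ ((1 + 2 * γ) * (N + 1 : ℕ)) * (U τ) (N + 1) ^ 3) + c₂ / 4 *
      (lam ^ ((1 + 2 * γ) * (N + 2 : ℕ)) * (U τ) (N + 2) ^ 3) + 2 * lam ^ (1 + 2 * γ) *
      (lam ^ ((1 + 2 * γ) * (N + 1 : ℕ)) * ((U τ) (N + 1) ^ 2 * (U τ) (N + 2)))) :=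
    ((continuous_const.mul cG).sub continuous_const).sub cR
  -- the fundamental theorem of calculus for `H_N`
  have hFTC : ∫ τ in s..t,
      ((∑ m ∈ Finset.range (N + 1), lam ^ (2 * γ * (m + 1 : ℕ)) *
      (2 * (U τ) (m + 1) * cheskidovRHS lam ν α g (U τ) (m + 1))) + c₂ *
      (∑ m ∈ Finset.range N, lam ^ (2 * γ * (m + 1 : ℕ)) *
      (cheskidovRHS lam ν α g (U τ) (m + 1) * (U τ) (m + 2) + (U τ) (m + 1) *
      cheskidovRHS lam ν α g (U τ) (m + 2)))) =
      ((∑ m ∈ Finset.range (N + 1), lam ^ (2 * γ * (m + 1 : ℕ)) * (U t) (m + 1) ^ 2) + c₂ *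
          (∑ m ∈ Finset.range N, lam ^ (2 * γ * (m + 1 : ℕ)) * ((U t) (m + 1) * (U t) (m + 2)))) -
          ((∑ m ∈ Finset.range (N + 1), lam ^ (2 * γ * (m + 1 : ℕ)) * (U s) (m + 1) ^ 2) + c₂ *
          (∑ m ∈ Finset.range N, lam ^ (2 * γ * (m + 1 : ℕ)) * ((U s) (m + 1) * (U s) (m + 2)))) :=
    intervalIntegral.integral_eq_sub_of_hasDeriv_right_of_le hst
      (continuous_lyapunov hcont c₂ N).continuousOn
      (fun τ hτ => (hasDerivWithinAt_lyapunov hder c₂ N (hs.trans hτ.1.le)).mono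
        fun x hx => (hs.trans hτ.1.le).trans (le_of_lt hx))
      ((continuous_lyapunov_deriv hcont c₂ N).intervalIntegrable _ _)
  -- integrate the state inequality
  have hmono : ∫ τ in s..t,
      (q * (∑ m ∈ Finset.range N, lam ^ ((1 + 2 * γ) * (m + 1 : ℕ)) * (U τ) (m + 1) ^ 3) - K -
      ((q + 3 * c₂ / 4) * (lam ^ ((1 + 2 * γ) * (N + 1 : ℕ)) * (U τ) (N + 1) ^ 3) + c₂ / 4 *
      (lam ^ ((1 + 2 * γ) * (N + 2 : ℕ)) * (U τ) (N + 2) ^ 3) + 2 * lam ^ (1 + 2 * γ) *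
      (lam ^ ((1 + 2 * γ) * (N + 1 : ℕ)) * ((U τ) (N + 1) ^ 2 * (U τ) (N + 2))))) ≤
      ∫ τ in s..t,
          ((∑ m ∈ Finset.range (N + 1), lam ^ (2 * γ * (m + 1 : ℕ)) *
          (2 * (U τ) (m + 1) * cheskidovRHS lam ν α g (U τ) (m + 1))) + c₂ *
          (∑ m ∈ Finset.range N, lam ^ (2 * γ * (m + 1 : ℕ)) *
          (cheskidovRHS lam ν α g (U τ) (m + 1) * (U τ) (m + 2) + (U τ) (m + 1) *
          cheskidovRHS lam ν α g (U τ) (m + 2)))) :=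
    intervalIntegral.integral_mono_on hst (cψ.intervalIntegrable _ _)
      ((continuous_lyapunov_deriv hcont c₂ N).intervalIntegrable _ _)
      fun τ _ => hKineq (U τ) (hU0 τ) (hnn τ) N
  have hψ : ∫ τ in s..t,
      (q * (∑ m ∈ Finset.range N, lam ^ ((1 + 2 * γ) * (m + 1 : ℕ)) * (U τ) (m + 1) ^ 3) - K -
      ((q + 3 * c₂ / 4) * (lam ^ ((1 + 2 * γ) * (N + 1 : ℕ)) * (U τ) (N + 1) ^ 3) + c₂ / 4 *
      (lam ^ ((1 + 2 * γ) * (N + 2 : ℕ)) * (U τ) (N + 2) ^ 3) + 2 * lam ^ (1 + 2 * γ) *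
      (lam ^ ((1 + 2 * γ) * (N + 1 : ℕ)) * ((U τ) (N + 1) ^ 2 * (U τ) (N + 2))))) =
      q * (∫ τ in s..t,
          (∑ m ∈ Finset.range N, lam ^ ((1 + 2 * γ) * (m + 1 : ℕ)) * (U τ) (m + 1) ^ 3)) -
          (t - s) * K - ∫ τ in s..t,
          ((q + 3 * c₂ / 4) * (lam ^ ((1 + 2 * γ) * (N + 1 : ℕ)) * (U τ) (N + 1) ^ 3) + c₂ / 4 *
          (lam ^ ((1 + 2 * γ) * (N + 2 : ℕ)) * (U τ) (N + 2) ^ 3) + 2 * lam ^ (1 + 2 * γ) *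
          (lam ^ ((1 + 2 * γ) * (N + 1 : ℕ)) * ((U τ) (N + 1) ^ 2 * (U τ) (N + 2)))) := by
    rw [intervalIntegral.integral_sub (((cG.intervalIntegrable _ _).const_mul q).sub
        intervalIntegrable_const) (cR.intervalIntegrable _ _),
      intervalIntegral.integral_sub ((cG.intervalIntegrable _ _).const_mul q)
        intervalIntegrable_const,
      intervalIntegral.integral_const_mul, intervalIntegral.integral_const, smul_eq_mul]
  set X := ∫ τ in s..t,
      (∑ m ∈ Finset.range N, lam ^ ((1 + 2 * γ) * (m + 1 : ℕ)) * (U τ) (m + 1) ^ 3) with hXdef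
  set Y := ∫ τ in s..t,
      ((q + 3 * c₂ / 4) * (lam ^ ((1 + 2 * γ) * (N + 1 : ℕ)) * (U τ) (N + 1) ^ 3) + c₂ / 4 *
      (lam ^ ((1 + 2 * γ) * (N + 2 : ℕ)) * (U τ) (N + 2) ^ 3) + 2 * lam ^ (1 + 2 * γ) *
      (lam ^ ((1 + 2 * γ) * (N + 1 : ℕ)) * ((U τ) (N + 1) ^ 2 * (U τ) (N + 2)))) with hYdef
  have hX0 : 0 ≤ X := intervalIntegral.integral_nonneg hst fun τ _ =>
    Finset.sum_nonneg fun m _ => hgT τ (m + 1)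
  have hY0 : 0 ≤ Y := intervalIntegral.integral_nonneg hst fun τ _ =>
    add_nonneg (add_nonneg (mul_nonneg (by positivity) (hgT τ _))
      (mul_nonneg (by positivity) (hgT τ _))) (mul_nonneg hL (hfT τ _))
  have hreal :
      ((∑ m ∈ Finset.range (N + 1), lam ^ (2 * γ * (m + 1 : ℕ)) * (U s) (m + 1) ^ 2) + c₂ *
      (∑ m ∈ Finset.range N, lam ^ (2 * γ * (m + 1 : ℕ)) * ((U s) (m + 1) * (U s) (m + 2)))) + q *
      X ≤
      ((∑ m ∈ Finset.range (N + 1), lam ^ (2 * γ * (m + 1 : ℕ)) * (U t) (m + 1) ^ 2) + c₂ *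
          (∑ m ∈ Finset.range N, lam ^ (2 * γ * (m + 1 : ℕ)) * ((U t) (m + 1) * (U t) (m + 2)))) +
          K * (t - s) + Y := by
    linarith
  -- identify the integrals with lower Lebesgue integrals
  have eX : ENNReal.ofReal X =
      ∑ m ∈ Finset.range N, ∫⁻ τ in Icc s t,
          ENNReal.ofReal ((lam ^ ((1 + 2 * γ) * (m + 1 : ℕ)) * (U τ) (m + 1) ^ 3)) := by
    rw [hXdef, intervalIntegral.integral_finsetSum fun m _ =>
        (continuous_gT hcont (m + 1)).intervalIntegrable _ _,
      ENNReal.ofReal_sum_of_nonneg fun m _ =>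
        intervalIntegral.integral_nonneg hst fun τ _ => hgT τ (m + 1)]
    exact Finset.sum_congr rfl fun m _ =>
      ofReal_intervalIntegral_eq (continuous_gT hcont (m + 1)) (fun τ => hgT τ (m + 1)) hst
  have eY : ENNReal.ofReal Y =
      ENNReal.ofReal (q + 3 * c₂ / 4) *
          (∫⁻ τ in Icc s t,
          ENNReal.ofReal ((lam ^ ((1 + 2 * γ) * (N + 1 : ℕ)) * (U τ) (N + 1) ^ 3))) +
        ENNReal.ofReal (c₂ / 4) *
          (∫⁻ τ in Icc s t, ENNReal.ofReal (lam ^ ((1 + 2 * γ : ℝ) * ((N + 2 : ℕ) : ℝ)) *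
            U τ (N + 2) ^ 3)) +
        ENNReal.ofReal (2 * lam ^ (1 + 2 * γ)) *
            (∫⁻ τ in Icc s t,
            ENNReal.ofReal
            ((lam ^ ((1 + 2 * γ) * (N + 1 : ℕ)) * ((U τ) (N + 1) ^ 2 * (U τ) (N + 2))))) := by
    have i1 := (continuous_gT (lam := lam) (γ := γ) hcont (N + 1)).intervalIntegrable (μ := volume)
        s t
    have i2 := (continuous_gT (lam := lam) (γ := γ) hcont (N + 2)).intervalIntegrable (μ := volume)
        s t
    have i3 := (continuous_fT (lam := lam) (γ := γ) hcont (N + 1)).intervalIntegrable (μ := volume)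
        s t
    have n1 : 0 ≤ ∫ τ in s..t, (lam ^ ((1 + 2 * γ) * (N + 1 : ℕ)) * (U τ) (N + 1) ^ 3) :=
      intervalIntegral.integral_nonneg hst fun τ _ => hgT τ (N + 1)
    have n2 : 0 ≤ ∫ τ in s..t, lam ^ ((1 + 2 * γ : ℝ) * ((N + 2 : ℕ) : ℝ)) * U τ (N + 2) ^ 3 :=
      intervalIntegral.integral_nonneg hst fun τ _ => hgT τ (N + 2)
    have n3 : 0 ≤ ∫ τ in s..t,
        (lam ^ ((1 + 2 * γ) * (N + 1 : ℕ)) * ((U τ) (N + 1) ^ 2 * (U τ) (N + 2))) :=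
      intervalIntegral.integral_nonneg hst fun τ _ => hfT τ (N + 1)
    have c1 : ∫ τ in s..t, (q + 3 * c₂ / 4) *
        (lam ^ ((1 + 2 * γ) * (N + 1 : ℕ)) * (U τ) (N + 1) ^ 3) =
        (q + 3 * c₂ / 4) * ∫ τ in s..t, (lam ^ ((1 + 2 * γ) * (N + 1 : ℕ)) * (U τ) (N + 1) ^ 3) :=
            intervalIntegral.integral_const_mul _ _
    have c2 : ∫ τ in s..t, c₂ / 4 *
        (lam ^ ((1 + 2 * γ : ℝ) * ((N + 2 : ℕ) : ℝ)) * U τ (N + 2) ^ 3) =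
        c₂ / 4 * ∫ τ in s..t, lam ^ ((1 + 2 * γ : ℝ) * ((N + 2 : ℕ) : ℝ)) * U τ (N + 2) ^ 3 :=
      intervalIntegral.integral_const_mul _ _
    have c3 : ∫ τ in s..t, 2 * lam ^ (1 + 2 * γ) *
        (lam ^ ((1 + 2 * γ) * (N + 1 : ℕ)) * ((U τ) (N + 1) ^ 2 * (U τ) (N + 2))) =
        2 * lam ^ (1 + 2 * γ) * ∫ τ in s..t,
            (lam ^ ((1 + 2 * γ) * (N + 1 : ℕ)) * ((U τ) (N + 1) ^ 2 * (U τ) (N + 2))) :=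
            intervalIntegral.integral_const_mul _ _
    rw [hYdef, intervalIntegral.integral_add ((i1.const_mul _).add (i2.const_mul _))
        (i3.const_mul _), intervalIntegral.integral_add (i1.const_mul _) (i2.const_mul _),
      c1, c2, c3,
      ENNReal.ofReal_add (add_nonneg (mul_nonneg (by positivity) n1)
        (mul_nonneg (by positivity) n2)) (mul_nonneg hL n3),
      ENNReal.ofReal_add (mul_nonneg (by positivity) n1) (mul_nonneg (by positivity) n2),
      ENNReal.ofReal_mul (by positivity), ENNReal.ofReal_mul (by positivity),
      ENNReal.ofReal_mul hL,
      ofReal_intervalIntegral_eq (continuous_gT hcont (N + 1)) (fun τ => hgT τ (N + 1)) hst,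
      ofReal_intervalIntegral_eq (continuous_gT hcont (N + 2)) (fun τ => hgT τ (N + 2)) hst,
      ofReal_intervalIntegral_eq (continuous_fT hcont (N + 1)) (fun τ => hfT τ (N + 1)) hst]
  have h1 := ENNReal.ofReal_le_ofReal hreal
  rw [ENNReal.ofReal_add (hHN s) (mul_nonneg hq hX0), ENNReal.ofReal_mul hq, eX,
    ENNReal.ofReal_add (add_nonneg (hHN t) (mul_nonneg hK (by linarith))) hY0,
    ENNReal.ofReal_add (hHN t) (mul_nonneg hK (by linarith)), eY] at h1
  exact h1

end solution

section limit

variable {U : ℝ → ℕ → ℝ}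

/-- **The Lyapunov inequality in the limit `N → ∞`** (monotone convergence for the cubic sums,
and the remainders `R_N` — single terms of the convergent cubic and flux series — tend to zero):
`H(s) + q∫ₛᵗ∑λ^{(1+2γ)n}uₙ³ ≤ H(t) + K(t-s)` for the Lyapunov function `H = sup_N H_N`.
[cite: Cheskidov2008, §5 proof of Thm. 5.3, (5.7)–(5.8)] -/
theorem lyapunov_integral_ineq (hlam : 1 < lam) {c₂ q K : ℝ} (hc₂ : 0 ≤ c₂) (hq : 0 ≤ q)
    (hK : 0 ≤ K)
    (hKineq : ∀ v : ℕ → ℝ, v 0 = 0 → (∀ n, 0 ≤ v n) → ∀ N : ℕ,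
      q * (∑ m ∈ Finset.range N, lam ^ ((1 + 2 * γ) * (m + 1 : ℕ)) * v (m + 1) ^ 3) - K -
          ((q + 3 * c₂ / 4) * (lam ^ ((1 + 2 * γ) * (N + 1 : ℕ)) * v (N + 1) ^ 3) + c₂ / 4 *
          (lam ^ ((1 + 2 * γ) * (N + 2 : ℕ)) * v (N + 2) ^ 3) + 2 * lam ^ (1 + 2 * γ) *
          (lam ^ ((1 + 2 * γ) * (N + 1 : ℕ)) * (v (N + 1) ^ 2 * v (N + 2)))) ≤
          (∑ m ∈ Finset.range (N + 1), lam ^ (2 * γ * (m + 1 : ℕ)) *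
          (2 * v (m + 1) * cheskidovRHS lam ν α g v (m + 1))) + c₂ *
          (∑ m ∈ Finset.range N, lam ^ (2 * γ * (m + 1 : ℕ)) *
          (cheskidovRHS lam ν α g v (m + 1) * v (m + 2) + v (m + 1) *
          cheskidovRHS lam ν α g v (m + 2))))
    (hU0 : ∀ τ, U τ 0 = 0)
    (hder : ∀ m τ, 0 ≤ τ → HasDerivWithinAt (fun s => U s (m + 1))
      (cheskidovRHS lam ν α g (U τ) (m + 1)) (Ici 0) τ)
    (hcont : ∀ k, Continuous fun s => U s k) (hnn : ∀ τ k, 0 ≤ U τ k)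
    {s t : ℝ} (hs : 0 ≤ s) (hst : s ≤ t)
    (hIG : ∑' m : ℕ,
        (∫⁻ τ in Icc s t, ENNReal.ofReal ((lam ^ ((1 + 2 * γ) * (m + 1 : ℕ)) * (U τ) (m + 1) ^ 3)))
        ≠ ⊤)
    (hIF : ∑' m : ℕ,
        (∫⁻ τ in Icc s t,
        ENNReal.ofReal ((lam ^ ((1 + 2 * γ) * (m + 1 : ℕ)) * ((U τ) (m + 1) ^ 2 * (U τ) (m + 2)))))
        ≠ ⊤) :
    (⨆ N : ℕ, ENNReal.ofReal
        ((∑ m ∈ Finset.range (N + 1), lam ^ (2 * γ * (m + 1 : ℕ)) * (U s) (m + 1) ^ 2) + c₂ *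
        (∑ m ∈ Finset.range N, lam ^ (2 * γ * (m + 1 : ℕ)) * ((U s) (m + 1) * (U s) (m + 2))))) +
        ENNReal.ofReal q * ∑' m : ℕ,
            (∫⁻ τ in Icc s t,
            ENNReal.ofReal ((lam ^ ((1 + 2 * γ) * (m + 1 : ℕ)) * (U τ) (m + 1) ^ 3))) ≤
      (⨆ N : ℕ, ENNReal.ofReal
          ((∑ m ∈ Finset.range (N + 1), lam ^ (2 * γ * (m + 1 : ℕ)) * (U t) (m + 1) ^ 2) + c₂ *
          (∑ m ∈ Finset.range N, lam ^ (2 * γ * (m + 1 : ℕ)) * ((U t) (m + 1) * (U t) (m + 2))))) +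
        ENNReal.ofReal (K * (t - s)) := by
  set Ig : ℕ → ℝ≥0∞ := fun m => ∫⁻ τ in Icc s t,
      ENNReal.ofReal ((lam ^ ((1 + 2 * γ) * (m + 1 : ℕ)) * (U τ) (m + 1) ^ 3)) with hIg
  set If : ℕ → ℝ≥0∞ := fun m => ∫⁻ τ in Icc s t,
      ENNReal.ofReal ((lam ^ ((1 + 2 * γ) * (m + 1 : ℕ)) * ((U τ) (m + 1) ^ 2 * (U τ) (m + 2))))
      with hIf
  have hineqN : ∀ N : ℕ,
      ENNReal.ofReal
      ((∑ m ∈ Finset.range (N + 1), lam ^ (2 * γ * (m + 1 : ℕ)) * (U s) (m + 1) ^ 2) + c₂ *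
      (∑ m ∈ Finset.range N, lam ^ (2 * γ * (m + 1 : ℕ)) * ((U s) (m + 1) * (U s) (m + 2)))) +
      ENNReal.ofReal q * ∑ m ∈ Finset.range N, Ig m ≤
      ENNReal.ofReal
          ((∑ m ∈ Finset.range (N + 1), lam ^ (2 * γ * (m + 1 : ℕ)) * (U t) (m + 1) ^ 2) + c₂ *
          (∑ m ∈ Finset.range N, lam ^ (2 * γ * (m + 1 : ℕ)) * ((U t) (m + 1) * (U t) (m + 2)))) +
          ENNReal.ofReal (K * (t - s)) +
        (ENNReal.ofReal (q + 3 * c₂ / 4) * Ig N + ENNReal.ofReal (c₂ / 4) * Ig (N + 1) +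
          ENNReal.ofReal (2 * lam ^ (1 + 2 * γ)) * If N) := fun N =>
    lyapunovN_integral_ineq hlam hc₂ hq hK hKineq hU0 hder hcont hnn hs hst N
  have hmono_s := lyapunov_mono (γ := γ) hlam hc₂ (hnn s)
  have hmono_t := lyapunov_mono (γ := γ) hlam hc₂ (hnn t)
  have hIg0 : Tendsto Ig atTop (𝓝 0) := ENNReal.tendsto_atTop_zero_of_tsum_ne_top hIG
  have hIf0 : Tendsto If atTop (𝓝 0) := ENNReal.tendsto_atTop_zero_of_tsum_ne_top hIF
  have hIg1 : Tendsto (fun N => Ig (N + 1)) atTop (𝓝 0) := hIg0.comp (tendsto_add_atTop_nat 1)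
  have hL : Tendsto
      (fun N => ENNReal.ofReal
      ((∑ m ∈ Finset.range (N + 1), lam ^ (2 * γ * (m + 1 : ℕ)) * (U s) (m + 1) ^ 2) + c₂ *
      (∑ m ∈ Finset.range N, lam ^ (2 * γ * (m + 1 : ℕ)) * ((U s) (m + 1) * (U s) (m + 2)))) +
      ENNReal.ofReal q * ∑ m ∈ Finset.range N, Ig m) atTop
      (𝓝 ((⨆ N : ℕ,
          ENNReal.ofReal
          ((∑ m ∈ Finset.range (N + 1), lam ^ (2 * γ * (m + 1 : ℕ)) * (U s) (m + 1) ^ 2) + c₂ *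
          (∑ m ∈ Finset.range N, lam ^ (2 * γ * (m + 1 : ℕ)) * ((U s) (m + 1) * (U s) (m + 2))))) +
        ENNReal.ofReal q * ∑' m, Ig m)) :=
    (tendsto_atTop_iSup hmono_s).add
      (ENNReal.Tendsto.const_mul (ENNReal.tendsto_nat_tsum Ig) (Or.inr ENNReal.ofReal_ne_top))
  have hR0 : Tendsto (fun N => ENNReal.ofReal (q + 3 * c₂ / 4) * Ig N +
      ENNReal.ofReal (c₂ / 4) * Ig (N + 1) + ENNReal.ofReal (2 * lam ^ (1 + 2 * γ)) * If N)
      atTop (𝓝 0) := by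
    have h1 := ENNReal.Tendsto.const_mul (a := ENNReal.ofReal (q + 3 * c₂ / 4)) hIg0
      (Or.inr ENNReal.ofReal_ne_top)
    have h2 := ENNReal.Tendsto.const_mul (a := ENNReal.ofReal (c₂ / 4)) hIg1
      (Or.inr ENNReal.ofReal_ne_top)
    have h3 := ENNReal.Tendsto.const_mul (a := ENNReal.ofReal (2 * lam ^ (1 + 2 * γ))) hIf0
      (Or.inr ENNReal.ofReal_ne_top)
    simpa using (h1.add h2).add h3
  have hR : Tendsto
      (fun N => ENNReal.ofReal
      ((∑ m ∈ Finset.range (N + 1), lam ^ (2 * γ * (m + 1 : ℕ)) * (U t) (m + 1) ^ 2) + c₂ *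
      (∑ m ∈ Finset.range N, lam ^ (2 * γ * (m + 1 : ℕ)) * ((U t) (m + 1) * (U t) (m + 2)))) +
      ENNReal.ofReal (K * (t - s)) +
      (ENNReal.ofReal (q + 3 * c₂ / 4) * Ig N + ENNReal.ofReal (c₂ / 4) * Ig (N + 1) +
        ENNReal.ofReal (2 * lam ^ (1 + 2 * γ)) * If N)) atTop
      (𝓝 ((⨆ N : ℕ,
          ENNReal.ofReal
          ((∑ m ∈ Finset.range (N + 1), lam ^ (2 * γ * (m + 1 : ℕ)) * (U t) (m + 1) ^ 2) + c₂ *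
          (∑ m ∈ Finset.range N, lam ^ (2 * γ * (m + 1 : ℕ)) * ((U t) (m + 1) * (U t) (m + 2))))) +
        ENNReal.ofReal (K * (t - s)) + 0)) :=
    ((tendsto_atTop_iSup hmono_t).add tendsto_const_nhds).add hR0
  rw [add_zero] at hR
  exact le_of_tendsto_of_tendsto' hL hR hineqN

end limit

/-! ## The Riccati endgame: blow-up of the Lyapunov function -/

section endgame

/-- `∑_{m<N} r^m ≤ 1/(1-r)` for `0 ≤ r < 1`. [folklore] -/
theorem geom_sum_le_inv {r : ℝ} (hr0 : 0 ≤ r) (hr1 : r < 1) (N : ℕ) :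
    ∑ m ∈ Finset.range N, r ^ m ≤ 1 / (1 - r) := by
  have h1 : (∑ m ∈ Finset.range N, r ^ m) * (1 - r) = 1 - r ^ N := geom_sum_mul_neg r N
  rw [le_div_iff₀ (by linarith), h1]
  linarith [pow_nonneg hr0 N]

/-- **Blow-up for the integral Riccati inequality** (the comparison with `y' = cy^{3/2}` at the
end of the printed proof, in a discrete form): if `H : ℝ → [0,∞]` satisfies
`H(s) + c₀∫ₛᵗH^{3/2} ≤ H(t) + K(t-s)` for `0 ≤ s ≤ t ≤ T₀` and `H(0) ≥ h ≥ 1 + 2K·(32/c₀)`, then the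
levels `4ᵏh` are reached at times `tₖ = ∑_{j<k}(32/c₀)/(2ʲ√h) ≤ 64/c₀` (each step quadruples the
level: on `[tₖ, tₖ₊₁]` the loss is at most `¾` of the level while the gain is `4` times the
level), so `H = ∞` on `[64/c₀, 64/c₀ + 1]`. [cite: Cheskidov2008, §5 proof of Thm. 5.3, (5.9)] -/
theorem lyapunov_blowup {H : ℝ → ℝ≥0∞} {c₀ K T₀ h : ℝ} (hc₀ : 0 < c₀) (hK : 0 ≤ K)
    (hineq : ∀ s t : ℝ, 0 ≤ s → s ≤ t → t ≤ T₀ →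
      H s + ENNReal.ofReal c₀ * (∫⁻ τ in Icc s t, H τ ^ (3 / 2 : ℝ)) ≤
        H t + ENNReal.ofReal (K * (t - s)))
    (hh : 1 + 2 * K * (32 / c₀) ≤ h) (hH0 : ENNReal.ofReal h ≤ H 0)
    (hT₀ : 2 * (32 / c₀) + 1 ≤ T₀) :
    ∀ t ∈ Icc (2 * (32 / c₀)) (2 * (32 / c₀) + 1), H t = ⊤ := by
  set B := 32 / c₀ with hB
  have hBpos : 0 < B := by positivity
  have hKB : 0 ≤ K * B := mul_nonneg hK hBpos.le
  have hh1 : 1 ≤ h := by nlinarith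
  -- one quadrupling step
  have step : ∀ s z : ℝ, 0 ≤ s → 0 < z → h ≤ z ^ 2 → s + B / z ≤ T₀ →
      ENNReal.ofReal (z ^ 2) ≤ H s → ENNReal.ofReal ((2 * z) ^ 2) ≤ H (s + B / z) := by
    intro s z hs0 hz hzh hsT hHs
    have hz1 : 1 ≤ z := by nlinarith
    have hΔ : 0 < B / z := div_pos hBpos hz
    have hloss : K * (B / z) ≤ 3 * z ^ 2 / 4 := by
      have h1 : K * (B / z) ≤ K * B := by
        refine mul_le_mul_of_nonneg_left ?_ hK
        rw [div_le_iff₀ hz]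
        nlinarith
      nlinarith
    -- the level does not drop below a quarter
    have stepA : ∀ τ ∈ Icc s (s + B / z), ENNReal.ofReal ((z / 2) ^ 2) ≤ H τ := by
      intro τ hτ
      have h1 := hineq s τ hs0 hτ.1 (hτ.2.trans hsT)
      have h2 : ENNReal.ofReal (K * (τ - s)) ≤ ENNReal.ofReal (3 * z ^ 2 / 4) :=
        ENNReal.ofReal_le_ofReal (by nlinarith [hτ.1, hτ.2])
      have h3 : ENNReal.ofReal (z ^ 2) ≤ H τ + ENNReal.ofReal (3 * z ^ 2 / 4) :=
        calc ENNReal.ofReal (z ^ 2) ≤ H s := hHs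
          _ ≤ H s + ENNReal.ofReal c₀ * ∫⁻ τ' in Icc s τ, H τ' ^ (3 / 2 : ℝ) := le_self_add
          _ ≤ H τ + ENNReal.ofReal (K * (τ - s)) := h1
          _ ≤ H τ + ENNReal.ofReal (3 * z ^ 2 / 4) := add_le_add le_rfl h2
      by_contra hlt
      have hlt' : H τ < ENNReal.ofReal ((z / 2) ^ 2) := lt_of_not_ge hlt
      have h4 : H τ + ENNReal.ofReal (3 * z ^ 2 / 4) <
          ENNReal.ofReal ((z / 2) ^ 2) + ENNReal.ofReal (3 * z ^ 2 / 4) :=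
        ENNReal.add_lt_add_right ENNReal.ofReal_ne_top hlt'
      rw [← ENNReal.ofReal_add (by positivity) (by positivity),
        show (z / 2) ^ 2 + 3 * z ^ 2 / 4 = z ^ 2 by ring] at h4
      exact absurd (lt_of_le_of_lt h3 h4) (lt_irrefl _)
    -- the gain over the step
    have stepB : ENNReal.ofReal ((z / 2) ^ 3 * (B / z)) ≤
        ∫⁻ τ in Icc s (s + B / z), H τ ^ (3 / 2 : ℝ) := by
      have hmono := setLIntegral_mono' (μ := volume) (s := Icc s (s + B / z))
        (f := fun _ => ENNReal.ofReal ((z / 2) ^ 2) ^ (3 / 2 : ℝ))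
        (g := fun τ => H τ ^ (3 / 2 : ℝ)) measurableSet_Icc
        fun τ hτ => ENNReal.rpow_le_rpow (stepA τ hτ) (by norm_num)
      rw [setLIntegral_const, Real.volume_Icc, show s + B / z - s = B / z by ring] at hmono
      refine le_trans (le_of_eq ?_) hmono
      rw [ENNReal.ofReal_rpow_of_nonneg (by positivity) (by norm_num),
        ← ENNReal.ofReal_mul (by positivity)]
      congr 1
      have : ((z / 2) ^ 2) ^ (3 / 2 : ℝ) = (z / 2) ^ 3 := by
        rw [← Real.rpow_natCast (z / 2) 2, ← Real.rpow_mul (by positivity),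
          ← Real.rpow_natCast (z / 2) 3]
        norm_num
      rw [this]
    have hgain : ENNReal.ofReal c₀ * ENNReal.ofReal ((z / 2) ^ 3 * (B / z)) =
        ENNReal.ofReal (4 * z ^ 2) := by
      rw [← ENNReal.ofReal_mul hc₀.le]
      congr 1
      rw [hB]
      field_simp
      ring
    have h1 := hineq s (s + B / z) hs0 (by linarith) hsT
    have h2 : ENNReal.ofReal (z ^ 2) + ENNReal.ofReal (4 * z ^ 2) ≤
        H (s + B / z) + ENNReal.ofReal (3 * z ^ 2 / 4) :=
      calc ENNReal.ofReal (z ^ 2) + ENNReal.ofReal (4 * z ^ 2)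
          ≤ H s + ENNReal.ofReal c₀ * ∫⁻ τ in Icc s (s + B / z), H τ ^ (3 / 2 : ℝ) :=
            add_le_add hHs (by rw [← hgain]; exact mul_le_mul_of_nonneg_left stepB bot_le)
        _ ≤ H (s + B / z) + ENNReal.ofReal (K * (s + B / z - s)) := h1
        _ ≤ H (s + B / z) + ENNReal.ofReal (3 * z ^ 2 / 4) :=
            add_le_add le_rfl (ENNReal.ofReal_le_ofReal (by
              rw [show s + B / z - s = B / z by ring]; exact hloss))
    by_contra hlt
    have hlt' : H (s + B / z) < ENNReal.ofReal ((2 * z) ^ 2) := lt_of_not_ge hlt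
    have h3 : H (s + B / z) + ENNReal.ofReal (3 * z ^ 2 / 4) <
        ENNReal.ofReal ((2 * z) ^ 2) + ENNReal.ofReal (3 * z ^ 2 / 4) :=
      ENNReal.add_lt_add_right ENNReal.ofReal_ne_top hlt'
    rw [← ENNReal.ofReal_add (by positivity) (by positivity)] at h3
    rw [← ENNReal.ofReal_add (by positivity) (by positivity)] at h2
    have h4 := lt_of_le_of_lt h2 h3
    rw [ENNReal.ofReal_lt_ofReal_iff (by positivity)] at h4
    nlinarith
  -- iteration along the levels `4ᵏ h` at the times `t_k`
  set z : ℕ → ℝ := fun k => 2 ^ k * Real.sqrt h with hz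
  set tk : ℕ → ℝ := fun k => ∑ j ∈ Finset.range k, B / z j with htk
  have hsq : Real.sqrt h ^ 2 = h := Real.sq_sqrt (by linarith)
  have hsqrt1 : 1 ≤ Real.sqrt h := by
    rw [show (1 : ℝ) = Real.sqrt 1 by simp]
    exact Real.sqrt_le_sqrt hh1
  have hzpos : ∀ k, 0 < z k := fun k => by positivity
  have hz2 : ∀ k, z k ^ 2 = 4 ^ k * h := fun k => by
    simp only [hz]
    rw [mul_pow, hsq, ← pow_mul, mul_comm k 2, pow_mul]
    norm_num
  have hzsucc : ∀ k, z (k + 1) = 2 * z k := fun k => by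
    simp only [hz, pow_succ]
    ring
  have htk_succ : ∀ k, tk (k + 1) = tk k + B / z k := fun k => Finset.sum_range_succ _ _
  have htk0 : ∀ k, 0 ≤ tk k := fun k =>
    Finset.sum_nonneg fun j _ => (div_pos hBpos (hzpos j)).le
  have htk_le : ∀ k, tk k ≤ 2 * B := by
    intro k
    have hterm : ∀ j, B / z j ≤ B * (1 / 2) ^ j := fun j => by
      have hzj : (2 : ℝ) ^ j ≤ z j := by
        show (2 : ℝ) ^ j ≤ 2 ^ j * Real.sqrt h
        exact le_mul_of_one_le_right (by positivity) hsqrt1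
      rw [div_le_iff₀ (hzpos j), one_div_pow, mul_assoc]
      refine le_mul_of_one_le_right hBpos.le ?_
      rw [one_div, ← div_eq_inv_mul, le_div_iff₀ (by positivity), one_mul]
      exact hzj
    calc tk k ≤ ∑ j ∈ Finset.range k, B * (1 / 2) ^ j := Finset.sum_le_sum fun j _ => hterm j
      _ = B * ∑ j ∈ Finset.range k, (1 / 2 : ℝ) ^ j := (Finset.mul_sum _ _ _).symm
      _ ≤ B * (1 / (1 - 1 / 2)) :=
          mul_le_mul_of_nonneg_left (geom_sum_le_inv (by norm_num) (by norm_num) k) hBpos.le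
      _ = 2 * B := by ring
  have hiter : ∀ k, ENNReal.ofReal (z k ^ 2) ≤ H (tk k) := by
    intro k
    induction k with
    | zero =>
      have h0 : tk 0 = 0 := Finset.sum_range_zero _
      have h0' : z 0 ^ 2 = h := by rw [hz2]; ring
      rw [h0, h0']
      exact hH0
    | succ k ih =>
      rw [htk_succ, hzsucc]
      refine step (tk k) (z k) (htk0 k) (hzpos k) ?_ ?_ ih
      · rw [hz2]
        have : (1 : ℝ) ≤ 4 ^ k := one_le_pow₀ (by norm_num)
        nlinarith
      · have := htk_le (k + 1)
        rw [htk_succ] at this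
        linarith
  -- conclusion: `H t ≥ 4ᵏ h - K T₀` for every `k`
  intro t ht
  by_contra hne
  have hfin : H t + ENNReal.ofReal (K * T₀) ≠ ⊤ :=
    ENNReal.add_ne_top.2 ⟨hne, ENNReal.ofReal_ne_top⟩
  have hbound : ∀ k, ENNReal.ofReal (4 ^ k * h) ≤ H t + ENNReal.ofReal (K * T₀) := by
    intro k
    have ht1 : tk k ≤ t := (htk_le k).trans ht.1
    have h1 := hineq (tk k) t (htk0 k) ht1 (ht.2.trans hT₀)
    calc ENNReal.ofReal (4 ^ k * h) = ENNReal.ofReal (z k ^ 2) := by rw [hz2]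
      _ ≤ H (tk k) := hiter k
      _ ≤ H (tk k) + ENNReal.ofReal c₀ * ∫⁻ τ in Icc (tk k) t, H τ ^ (3 / 2 : ℝ) := le_self_add
      _ ≤ H t + ENNReal.ofReal (K * (t - tk k)) := h1
      _ ≤ H t + ENNReal.ofReal (K * T₀) := add_le_add le_rfl (ENNReal.ofReal_le_ofReal
          (mul_le_mul_of_nonneg_left (by linarith [htk0 k, ht.2]) hK))
  obtain ⟨k, hk⟩ := pow_unbounded_of_one_lt (H t + ENNReal.ofReal (K * T₀)).toReal
    (by norm_num : (1 : ℝ) < 4)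
  have h1 := hbound k
  rw [ENNReal.ofReal_le_iff_le_toReal hfin] at h1
  have h2 : (4 : ℝ) ^ k ≤ 4 ^ k * h := le_mul_of_one_le_right (by positivity) hh1
  linarith

end endgame

/-! ## Assembly: blow-up of `∫₀ᵀ ‖u‖³_{1/3+γ}` -/

section assembly

variable {U : ℝ → ℕ → ℝ}

/-- **Main lemma** (the contradiction of the printed proof, for a solution written time-first,
continuous and non-negative): given the state inequality `h_N ≥ qG_N - K - R_N`, the bound
`H^{3/2} ≤ C_H ∑λ^{(1+2γ)n}uₙ³` and `H(0) ≥ h = 1 + 2K·(32/c₀)` with `c₀ = q/C_H`, the function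
`‖u(t)‖³_{1/3+γ}` has infinite integral over `[0, T₀]`, `T₀ = 64/c₀ + 1` (otherwise the cubic and
flux series are integrable, the Lyapunov function satisfies the integral Riccati inequality and
equals `∞` on `[64/c₀, 64/c₀+1]`, where then `‖u‖_{1/3+γ} = ∞`).
[cite: Cheskidov2008, §5 proof of Thm. 5.3] -/
theorem lintegral_eq_top_of_large (hlam : 1 < lam) (hγ : 0 ≤ γ)
    {c₂ q K CH : ℝ} (hc₂ : 0 ≤ c₂) (hq : 0 < q) (hK : 0 ≤ K) (hCH : 0 < CH)
    (hKineq : ∀ v : ℕ → ℝ, v 0 = 0 → (∀ n, 0 ≤ v n) → ∀ N : ℕ,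
      q * (∑ m ∈ Finset.range N, lam ^ ((1 + 2 * γ) * (m + 1 : ℕ)) * v (m + 1) ^ 3) - K -
          ((q + 3 * c₂ / 4) * (lam ^ ((1 + 2 * γ) * (N + 1 : ℕ)) * v (N + 1) ^ 3) + c₂ / 4 *
          (lam ^ ((1 + 2 * γ) * (N + 2 : ℕ)) * v (N + 2) ^ 3) + 2 * lam ^ (1 + 2 * γ) *
          (lam ^ ((1 + 2 * γ) * (N + 1 : ℕ)) * (v (N + 1) ^ 2 * v (N + 2)))) ≤
          (∑ m ∈ Finset.range (N + 1), lam ^ (2 * γ * (m + 1 : ℕ)) *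
          (2 * v (m + 1) * cheskidovRHS lam ν α g v (m + 1))) + c₂ *
          (∑ m ∈ Finset.range N, lam ^ (2 * γ * (m + 1 : ℕ)) *
          (cheskidovRHS lam ν α g v (m + 1) * v (m + 2) + v (m + 1) *
          cheskidovRHS lam ν α g v (m + 2))))
    (hHG : ∀ v : ℕ → ℝ, (∀ n, 0 ≤ v n) →
      (⨆ N : ℕ, ENNReal.ofReal
          ((∑ m ∈ Finset.range (N + 1), lam ^ (2 * γ * (m + 1 : ℕ)) * v (m + 1) ^ 2) + c₂ *
          (∑ m ∈ Finset.range N, lam ^ (2 * γ * (m + 1 : ℕ)) * (v (m + 1) * v (m + 2))))) ^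
          (3 / 2 : ℝ) ≤
        ENNReal.ofReal CH * ∑' m,
            ENNReal.ofReal ((lam ^ ((1 + 2 * γ) * (m + 1 : ℕ)) * v (m + 1) ^ 3)))
    (hU0 : ∀ τ, U τ 0 = 0)
    (hder : ∀ m τ, 0 ≤ τ → HasDerivWithinAt (fun s => U s (m + 1))
      (cheskidovRHS lam ν α g (U τ) (m + 1)) (Ici 0) τ)
    (hcont : ∀ k, Continuous fun s => U s k) (hnn : ∀ τ k, 0 ≤ U τ k)
    (hH0 : ENNReal.ofReal (1 + 2 * K * (32 / (q / CH))) ≤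
      ⨆ N : ℕ, ENNReal.ofReal
          ((∑ m ∈ Finset.range (N + 1), lam ^ (2 * γ * (m + 1 : ℕ)) * (U 0) (m + 1) ^ 2) + c₂ *
          (∑ m ∈ Finset.range N, lam ^ (2 * γ * (m + 1 : ℕ)) * ((U 0) (m + 1) * (U 0) (m + 2))))) :
    ∫⁻ τ in Icc 0 (2 * (32 / (q / CH)) + 1),
      dyadicNormSq lam (1 / 3 + γ) (U τ) ^ (3 / 2 : ℝ) = ⊤ := by
  set T₀ : ℝ := 2 * (32 / (q / CH)) + 1 with hT₀
  have hc₀ : 0 < q / CH := div_pos hq hCH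
  have hT₀pos : 0 < T₀ := by positivity
  by_contra hfin
  -- the cubic and flux series are integrable on `[0, T₀]`
  have hmeas_g : ∀ m : ℕ, Measurable fun τ =>
      ENNReal.ofReal ((lam ^ ((1 + 2 * γ) * (m + 1 : ℕ)) * (U τ) (m + 1) ^ 3)) := fun m =>
    (continuous_gT hcont (m + 1)).measurable.ennreal_ofReal
  have hmeas_f : ∀ m : ℕ, Measurable fun τ =>
      ENNReal.ofReal ((lam ^ ((1 + 2 * γ) * (m + 1 : ℕ)) * ((U τ) (m + 1) ^ 2 * (U τ) (m + 2)))) :=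
      fun m =>
    (continuous_fT hcont (m + 1)).measurable.ennreal_ofReal
  have hIG0 : ∫⁻ τ in Icc 0 T₀, ∑' m,
      ENNReal.ofReal ((lam ^ ((1 + 2 * γ) * (m + 1 : ℕ)) * (U τ) (m + 1) ^ 3)) ≠ ⊤ :=
    ne_top_of_le_ne_top hfin (lintegral_mono fun τ => cubic_tsum_le (γ := γ) hlam hγ (hnn τ))
  have hIF0 : ∫⁻ τ in Icc 0 T₀, ∑' m,
      ENNReal.ofReal ((lam ^ ((1 + 2 * γ) * (m + 1 : ℕ)) * ((U τ) (m + 1) ^ 2 * (U τ) (m + 2)))) ≠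
      ⊤ := by
    refine ne_top_of_le_ne_top (ENNReal.mul_ne_top ENNReal.ofNat_ne_top hIG0 :
      (2 : ℝ≥0∞) * ∫⁻ τ in Icc 0 T₀, ∑' m,
          ENNReal.ofReal ((lam ^ ((1 + 2 * γ) * (m + 1 : ℕ)) * (U τ) (m + 1) ^ 3)) ≠ ⊤) ?_
    rw [← lintegral_const_mul' _ _ ENNReal.ofNat_ne_top]
    exact lintegral_mono fun τ => flux_tsum_le (γ := γ) hlam hγ (hnn τ)
  -- the integral Riccati inequality for `H(τ) = sup_N H_N(U τ)`
  have hineq : ∀ s t : ℝ, 0 ≤ s → s ≤ t → t ≤ T₀ →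
      (⨆ N : ℕ, ENNReal.ofReal
          ((∑ m ∈ Finset.range (N + 1), lam ^ (2 * γ * (m + 1 : ℕ)) * (U s) (m + 1) ^ 2) + c₂ *
          (∑ m ∈ Finset.range N, lam ^ (2 * γ * (m + 1 : ℕ)) * ((U s) (m + 1) * (U s) (m + 2))))) +
        ENNReal.ofReal (q / CH) * (∫⁻ τ in Icc s t,
          (⨆ N : ℕ, ENNReal.ofReal
              ((∑ m ∈ Finset.range (N + 1), lam ^ (2 * γ * (m + 1 : ℕ)) * (U τ) (m + 1) ^ 2) + c₂ *
              (∑ m ∈ Finset.range N, lam ^ (2 * γ * (m + 1 : ℕ)) *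
              ((U τ) (m + 1) * (U τ) (m + 2))))) ^ (3 / 2 : ℝ)) ≤
      (⨆ N : ℕ, ENNReal.ofReal
          ((∑ m ∈ Finset.range (N + 1), lam ^ (2 * γ * (m + 1 : ℕ)) * (U t) (m + 1) ^ 2) + c₂ *
          (∑ m ∈ Finset.range N, lam ^ (2 * γ * (m + 1 : ℕ)) * ((U t) (m + 1) * (U t) (m + 2))))) +
        ENNReal.ofReal (K * (t - s)) := by
    intro s t hs hst htT
    have hsub : Icc s t ⊆ Icc 0 T₀ := Icc_subset_Icc hs htT
    have hG : ∫⁻ τ in Icc s t, ∑' m,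
        ENNReal.ofReal ((lam ^ ((1 + 2 * γ) * (m + 1 : ℕ)) * (U τ) (m + 1) ^ 3)) =
        ∑' m, ∫⁻ τ in Icc s t,
            ENNReal.ofReal ((lam ^ ((1 + 2 * γ) * (m + 1 : ℕ)) * (U τ) (m + 1) ^ 3)) :=
      lintegral_tsum fun m => (hmeas_g m).aemeasurable
    have hF : ∫⁻ τ in Icc s t, ∑' m,
        ENNReal.ofReal ((lam ^ ((1 + 2 * γ) * (m + 1 : ℕ)) * ((U τ) (m + 1) ^ 2 * (U τ) (m + 2)))) =
        ∑' m, ∫⁻ τ in Icc s t,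
            ENNReal.ofReal
            ((lam ^ ((1 + 2 * γ) * (m + 1 : ℕ)) * ((U τ) (m + 1) ^ 2 * (U τ) (m + 2)))) :=
      lintegral_tsum fun m => (hmeas_f m).aemeasurable
    have hIG : ∑' m,
        (∫⁻ τ in Icc s t, ENNReal.ofReal ((lam ^ ((1 + 2 * γ) * (m + 1 : ℕ)) * (U τ) (m + 1) ^ 3)))
        ≠ ⊤ := by
      rw [← hG]
      exact ne_top_of_le_ne_top hIG0 (lintegral_mono_set hsub)
    have hIF : ∑' m,
        (∫⁻ τ in Icc s t,
        ENNReal.ofReal ((lam ^ ((1 + 2 * γ) * (m + 1 : ℕ)) * ((U τ) (m + 1) ^ 2 * (U τ) (m + 2)))))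
        ≠ ⊤ := by
      rw [← hF]
      exact ne_top_of_le_ne_top hIF0 (lintegral_mono_set hsub)
    have h1 := lyapunov_integral_ineq hlam hc₂ hq.le hK hKineq hU0 hder hcont hnn hs hst hIG hIF
    have h2 : ∫⁻ τ in Icc s t,
        (⨆ N : ℕ, ENNReal.ofReal
            ((∑ m ∈ Finset.range (N + 1), lam ^ (2 * γ * (m + 1 : ℕ)) * (U τ) (m + 1) ^ 2) + c₂ *
            (∑ m ∈ Finset.range N, lam ^ (2 * γ * (m + 1 : ℕ)) * ((U τ) (m + 1) * (U τ) (m + 2)))))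
            ^ (3 / 2 : ℝ) ≤
        ENNReal.ofReal CH * ∑' m,
            (∫⁻ τ in Icc s t,
            ENNReal.ofReal ((lam ^ ((1 + 2 * γ) * (m + 1 : ℕ)) * (U τ) (m + 1) ^ 3))) := by
      rw [← hG, ← lintegral_const_mul' _ _ ENNReal.ofReal_ne_top]
      exact lintegral_mono fun τ => hHG (U τ) (hnn τ)
    have h3 : ENNReal.ofReal (q / CH) * (∫⁻ τ in Icc s t,
        (⨆ N : ℕ, ENNReal.ofReal
            ((∑ m ∈ Finset.range (N + 1), lam ^ (2 * γ * (m + 1 : ℕ)) * (U τ) (m + 1) ^ 2) + c₂ *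
            (∑ m ∈ Finset.range N, lam ^ (2 * γ * (m + 1 : ℕ)) * ((U τ) (m + 1) * (U τ) (m + 2)))))
            ^ (3 / 2 : ℝ)) ≤
        ENNReal.ofReal q * ∑' m,
            (∫⁻ τ in Icc s t,
            ENNReal.ofReal ((lam ^ ((1 + 2 * γ) * (m + 1 : ℕ)) * (U τ) (m + 1) ^ 3))) := by
      calc ENNReal.ofReal (q / CH) * (∫⁻ τ in Icc s t,
            (⨆ N : ℕ, ENNReal.ofReal
                ((∑ m ∈ Finset.range (N + 1), lam ^ (2 * γ * (m + 1 : ℕ)) * (U τ) (m + 1) ^ 2) +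
                c₂ * (∑ m ∈ Finset.range N, lam ^ (2 * γ * (m + 1 : ℕ)) *
                ((U τ) (m + 1) * (U τ) (m + 2))))) ^ (3 / 2 : ℝ))
          ≤ ENNReal.ofReal (q / CH) * (ENNReal.ofReal CH *
              ∑' m, (∫⁻ τ in Icc s t,
                  ENNReal.ofReal ((lam ^ ((1 + 2 * γ) * (m + 1 : ℕ)) * (U τ) (m + 1) ^ 3)))) :=
            mul_le_mul_of_nonneg_left h2 bot_le
        _ = ENNReal.ofReal q * ∑' m,
            (∫⁻ τ in Icc s t,
            ENNReal.ofReal ((lam ^ ((1 + 2 * γ) * (m + 1 : ℕ)) * (U τ) (m + 1) ^ 3))) := by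
            rw [← mul_assoc, ← ENNReal.ofReal_mul hc₀.le, div_mul_cancel₀ q hCH.ne']
    exact (add_le_add le_rfl h3).trans h1
  -- blow-up of the Lyapunov function
  have htop :=
      lyapunov_blowup
      (H := fun τ => ⨆ N : ℕ,
      ENNReal.ofReal
      ((∑ m ∈ Finset.range (N + 1), lam ^ (2 * γ * (m + 1 : ℕ)) * (U τ) (m + 1) ^ 2) + c₂ *
      (∑ m ∈ Finset.range N, lam ^ (2 * γ * (m + 1 : ℕ)) * ((U τ) (m + 1) * (U τ) (m + 2)))))
    hc₀ hK hineq le_rfl hH0 le_rfl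
  -- hence `‖u(τ)‖_{1/3+γ} = ∞` on an interval of length one
  have hnorm : ∀ τ ∈ Icc (2 * (32 / (q / CH))) (2 * (32 / (q / CH)) + 1),
      dyadicNormSq lam (1 / 3 + γ) (U τ) ^ (3 / 2 : ℝ) = ⊤ := by
    intro τ hτ
    have h1 := lyapunov_le_dyadicNormSq (γ := γ) hlam hγ hc₂ (U τ)
    rw [htop τ hτ, top_le_iff] at h1
    have h2 : dyadicNormSq lam (1 / 3 + γ) (U τ) = ⊤ := by
      rcases ENNReal.mul_eq_top.1 h1 with h | h
      · exact h.2
      · exact absurd h.1 ENNReal.ofReal_ne_top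
    rw [h2, ENNReal.top_rpow_of_pos (by norm_num)]
  have hge : ∫⁻ τ in Icc (2 * (32 / (q / CH))) (2 * (32 / (q / CH)) + 1),
      dyadicNormSq lam (1 / 3 + γ) (U τ) ^ (3 / 2 : ℝ) ≤
      ∫⁻ τ in Icc 0 T₀, dyadicNormSq lam (1 / 3 + γ) (U τ) ^ (3 / 2 : ℝ) :=
    lintegral_mono_set (Icc_subset_Icc (by positivity) le_rfl)
  rw [setLIntegral_congr_fun measurableSet_Icc hnorm, setLIntegral_const, Real.volume_Icc,
    show 2 * (32 / (q / CH)) + 1 - 2 * (32 / (q / CH)) = 1 by ring, ENNReal.ofReal_one, mul_one,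
    top_le_iff] at hge
  exact hfin hge

end assembly

/-! ## Proof of Theorem 5.3 -/

/-- **Cheskidov 2008, Theorem 5.3** (finite-time blow-up of the dyadic model for `α < 1/3`, in
the range `0 < γ < min{1/3, 1 - 3α}` its proof covers): the named fact `Cheskidov2008_thm53`
holds — for `λ > 1`, `ν > 0`, `0 < α < 1/3`, a non-negative square-summable force and
`0 < γ < min{1/3, 1-3α}` there is a finite threshold `M` such that every solution of (3.1) with
non-negative datum of `γ`-energy `‖u(0)‖²_γ > M` has `∫₀ᵀ ‖u(t)‖³_{1/3+γ} dt = ∞` for some `T > 0`.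
Proof as printed (positivity, Lemma 5.1, the Lyapunov function
`H = ‖u‖²_γ + c₂∑λ^{2γn}uₙuₙ₊₁` and the Riccati inequality `H(t) - H(0) ≳ ∫₀ᵗ H^{3/2}`), organised
through the truncations `H_N` and monotone convergence (`lintegral_eq_top_of_large`), which
avoids Lemma 5.2; the hypothesis `γ < 1/3` (used in print only to make the forcing term of (5.6)
integrable) is not needed in this organisation, the forcing term being dropped as non-negative.
[cite: Cheskidov2008, §5 Thm. 5.3] -/
theorem Cheskidov2008_thm53_holds : Cheskidov2008_thm53 := by
  intro lam ν α hlam hν hα hα3 g hg _hgs γ hγ _hγ3 hγα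
  have hl : 0 < lam := by linarith
  have hε : 0 < 2 - 6 * α - 2 * γ := by linarith
  have hγ1 : γ < 1 := by linarith
  -- the constants `c₂`, `q = c/2`, `K` (threshold) and `C_H` (Hölder)
  obtain ⟨c₂, hc₂pos, hK2⟩ : ∃ c₂ : ℝ, 0 < c₂ ∧
      c₂ * (3 * lam + lam ^ 2 / 2) = 2 * (lam ^ (1 + 2 * γ) - lam) := by
    have hc₁ : 0 < lam ^ (1 + 2 * γ) - lam := by
      have : lam ^ (1 : ℝ) < lam ^ (1 + 2 * γ) :=
        Real.rpow_lt_rpow_of_exponent_lt hlam (by linarith)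
      rw [Real.rpow_one] at this
      linarith
    have hKF : 0 < 3 * lam + lam ^ 2 / 2 := by positivity
    exact ⟨2 * (lam ^ (1 + 2 * γ) - lam) / (3 * lam + lam ^ 2 / 2), div_pos (by linarith) hKF,
      by field_simp⟩
  obtain ⟨q, hqpos, hqdef⟩ : ∃ q : ℝ, 0 < q ∧ q = c₂ * (lam - 3 / 4) / 2 := by
    have : 0 < lam - 3 / 4 := by linarith
    exact ⟨_, by positivity, rfl⟩
  obtain ⟨K, hK0, hKdef⟩ : ∃ K : ℝ, 0 ≤ K ∧ K = (ν * (2 + c₂ * (1 + lam ^ (2 * α)))) ^ 3 / q ^ 2 *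
      (lam ^ (-(2 - 6 * α - 2 * γ)) / (1 - lam ^ (-(2 - 6 * α - 2 * γ)))) := by
    have hr : lam ^ (-(2 - 6 * α - 2 * γ)) < 1 := rpow_neg_lt_one hlam hε
    have hSε : 0 ≤ lam ^ (-(2 - 6 * α - 2 * γ)) / (1 - lam ^ (-(2 - 6 * α - 2 * γ))) :=
      div_nonneg (Real.rpow_nonneg hl.le _) (by linarith)
    exact ⟨_, by positivity, rfl⟩
  obtain ⟨CH, hCH, hCHdef⟩ : ∃ CH : ℝ, 0 < CH ∧ CH = Real.sqrt ((1 + c₂) ^ 3 *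
      (lam ^ (-(2 * (1 - γ))) / (1 - lam ^ (-(2 * (1 - γ)))))) := by
    have hr' : lam ^ (-(2 * (1 - γ))) < 1 := rpow_neg_lt_one hlam (by linarith)
    exact ⟨_, Real.sqrt_pos.2 (mul_pos (by positivity)
      (div_pos (Real.rpow_pos_of_pos hl _) (by linarith))), rfl⟩
  -- the state inequalities with these constants
  have hc : 0 < c₂ * (lam - 3 / 4) := by
    have h := hqpos
    rw [hqdef] at h
    linarith
  have hKineq := fun (v : ℕ → ℝ) (hv0 : v 0 = 0) (hv : ∀ n, 0 ≤ v n) (N : ℕ) => by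
    have h := lyapunov_deriv_lower (ν := ν) (α := α) (γ := γ) (g := g) hlam hα.le hγ.le hν.le hε
      hg hc₂pos.le hK2 hc hv0 hv N
    rw [← hqdef, ← hKdef] at h
    exact h
  have hHG := fun (v : ℕ → ℝ) (hv : ∀ n, 0 ≤ v n) => by
    have h := lyapunov_rpow_le_tsum (γ := γ) hlam hγ.le hγ1 hc₂pos.le hv
    rw [← hCHdef] at h
    exact h
  refine ⟨ENNReal.ofReal (1 + 2 * K * (32 / (q / CH))), ENNReal.ofReal_lt_top, ?_⟩
  intro u0 u hu0 hsol hM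
  refine ⟨2 * (32 / (q / CH)) + 1, by positivity, ?_⟩
  -- the solution, written time-first and extended continuously to `t < 0`
  obtain ⟨U, hUdef⟩ : ∃ U : ℝ → ℕ → ℝ, U = fun τ k => u k (max τ 0) := ⟨_, rfl⟩
  obtain ⟨hU0, hder, hcont⟩ := extend_isCheskidovSolution hsol
  have hU0' : ∀ τ, U τ 0 = 0 := by rw [hUdef]; exact hU0
  have hder' : ∀ m τ, 0 ≤ τ → HasDerivWithinAt (fun s => U s (m + 1))
      (cheskidovRHS lam ν α g (U τ) (m + 1)) (Ici 0) τ := by rw [hUdef]; exact hder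
  have hcont' : ∀ k, Continuous fun s => U s k := by rw [hUdef]; exact hcont
  have hnn : ∀ τ k, 0 ≤ U τ k := by
    rw [hUdef]
    exact fun τ k => nonneg_of_isCheskidovSolution hl.le hg hu0 hsol k (max τ 0) (le_max_right _ _)
  have hnormeq : dyadicNormSq lam γ (U 0) = dyadicNormSq lam γ u0 := by
    rw [dyadicNormSq_eq_tsum_succ, dyadicNormSq_eq_tsum_succ]
    refine tsum_congr fun m => ?_
    rw [hUdef]
    simp only [max_self, hsol.2.1 (m + 1) le_add_self]
  have hmain := lintegral_eq_top_of_large (ν := ν) (α := α) (g := g) hlam hγ.le hc₂pos.le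
    hqpos hK0 hCH hKineq hHG hU0' hder' hcont' hnn
    (hM.le.trans (hnormeq ▸ dyadicNormSq_le_lyapunov (γ := γ) hlam hc₂pos.le (hnn 0)))
  rw [← hmain]
  refine setLIntegral_congr_fun measurableSet_Icc fun t ht => ?_
  rw [hUdef]
  simp only [max_eq_left ht.1]

end Literature.Barriers.NavierStokesRegularity.Dyadic
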